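import Mathlib
import Literature.NumberTheory.LFunctions.Zhang2022.Section8FrontEnd44Reduction
import Literature.NumberTheory.LFunctions.Zhang2022.Section8ConeLeaves823
import Literature.NumberTheory.LFunctions.Zhang2022.SkeletonLemma84Rel
import HarnessLib

/-!
# Zhang (2022) §8 pp. 47–50: the "simple approximation" `Z22:§8.u044` with the RELATIVE Lemma 8.4,
# and the cone leaves `Skeleton.Ded823Rel c′`, `Sec8C.SjWeightedEval c′`, `Sec8C.EcalNegligible c′`
# from `Skeleton.Lemma84Rel c′`

Topic `Literature/NumberTheory/LFunctions/Zhang2022` (Landau–Siegel audit tree; verdict-neutral).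
Y. Zhang, *Discrete mean estimates and the Landau–Siegel zero*, arXiv:2211.02515v1 (2022)
[Zhang2022LandauSiegel] — **an unrefereed manuscript under adjudication**; D-0069 campaign, cell
`siegel-zhang`, DISCHARGE lane (seat d20), cone C22 of Theorem 1. Companion of
`Section8FrontEnd44Reduction` (the absolute case). From the whole-DAG theorem v8 on, Lemma 8.4 enters
the cone in its RELATIVE form `Skeleton.Lemma84Rel c′` (error `C𝓛⁻⁶·(∏_{q∣dr}(1−q⁻¹)⁻¹)²`, rows
G-adj1-1 / G-d55-3: the printed contour argument carries a factor `|Π(d,r)|`), and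
`theorem1_of_leaves_v13` has the leaves `h84 : Lemma84Rel c′`, `hSj : Sec8C.SjWeightedEval c′`,
`hEc : Sec8C.EcalNegligible c′`. This file shows that **the relative error survives the gathering
step** — the manuscript's "simple approximation" goes through with `u042/u043` carrying the factor
`(∏_{q∣dr}(1−q⁻¹)⁻¹)² = (dr/φ(dr))² ≤ ∏_{q∣dr}(1+6/q)`, which the multiplicative weight machinery
absorbs (`∏(1+106/q)·∏(1+6/q) ≤ ∏(1+430/q)`; range totals unchanged up to the constant `e⁴³⁰`):

* `u042R_of_lemma84W`, `u043R_of_lemma84W` — the relative twins of seat d20's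
  `Section8FrontEnd84.step8u042/043_of_lemma84` (L2 LEDGER #12 (R45); proofs threaded with a
  weight `W(dr)` as in seat L2-t6's staged `Section8FrontEnd84Rel`);
* `pointwise_I_rel … pointwise_IV_rel`, `weight_antidiagonal_rel_le`, `range_sum_le_rel`, `coreRel` —
  the range bookkeeping of `Section8FrontEnd44Reduction` with the factor threaded through;
* `step8u044_of_rel`, `step8u044_of_lemma84Rel : 0 ≤ c′ → Lemma84Rel c′ → Step8u044 c′`,
  `eq812_of_lemma84Rel`, and the cone consequences **`ded823Rel_holds : 0 ≤ c′ → Ded823Rel c′`**,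
  **`sjWeightedEval_of_lemma84Rel`**, **`ecalNegligible_of_lemma84Rel`**
  (`0 ≤ c′ → Lemma84Rel c′ → Sec8C.SjWeightedEval c′ / Sec8C.EcalNegligible c′`): in
  `theorem1_of_leaves_v13` the leaves `hSj`, `hEc` are consequences of the leaf `h84`.

WHAT THIS FILE IS NOT: a proof of Lemma 8.4 in either form, of Proposition 7.1, or of anything
about the manuscript's Theorems 1–2 / Landau–Siegel zeros. Theorem-only; no definition, no new fact.

## References

* Y. Zhang, arXiv:2211.02515v1 (2022), §8 pp. 46–50 (Lemma 8.4, tex L2429–L2442, (8.10)–(8.12),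
  (8.23)). [cite: Zhang2022LandauSiegel, §8 pp.46–50]
-/

noncomputable section

open Complex Real ComplexConjugate Finset

namespace Literature.NumberTheory.LFunctions.Zhang2022.Section8FrontEnd44ReductionRel

open Literature.NumberTheory.LFunctions.Zhang2022.Skeleton
open Literature.NumberTheory.LFunctions.Zhang2022.Section8FrontEnd82
open Literature.NumberTheory.LFunctions.Zhang2022.Section8FrontEnd84
open Literature.NumberTheory.LFunctions.Zhang2022.Section8FrontEnd44Sizes
open Literature.NumberTheory.LFunctions.Zhang2022.Section8FrontEnd44Reduction

/-! ## The relative factor `(∏_{q∣n}(1−q⁻¹)⁻¹)² = (n/φ(n))²` -/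

/-- `1 ≤ (∏_{q∣n}(1−q⁻¹)⁻¹)²` (each prime `q ≥ 2`). [cite: Zhang2022LandauSiegel, §8 Lemma 8.4 p.46] -/
theorem one_le_relFac (n : ℕ) : 1 ≤ (∏ q ∈ n.primeFactors, (1 - (q : ℝ)⁻¹)⁻¹) ^ 2 := by
  have hprod : 1 ≤ ∏ q ∈ n.primeFactors, (1 - (q : ℝ)⁻¹)⁻¹ := by
    refine le_of_eq_of_le (Finset.prod_const_one (s := n.primeFactors)).symm
      (Finset.prod_le_prod (fun _ _ => zero_le_one) fun q hq => ?_)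
    have hq2 : (2 : ℝ) ≤ q := by exact_mod_cast (Nat.prime_of_mem_primeFactors hq).two_le
    have h1 : 0 < 1 - (q : ℝ)⁻¹ := by
      have : (q : ℝ)⁻¹ ≤ 1 / 2 := by rw [inv_eq_one_div]; gcongr
      linarith
    have h2 : 1 - (q : ℝ)⁻¹ ≤ 1 := by
      have : 0 ≤ (q : ℝ)⁻¹ := by positivity
      linarith
    exact (one_le_inv₀ h1).mpr h2
  nlinarith

/-- `(∏_{q∣n}(1−q⁻¹)⁻¹)² ≤ ∏_{q∣n}(1 + 6/q)` (`q²/(q−1)² ≤ 1 + 6/q` for `q ≥ 2`; as in seat L2-t6's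
staged `relW_le_prod_one_add_div`). [cite: Zhang2022LandauSiegel, §8 p.47] -/
theorem relFac_le_prod (n : ℕ) :
    (∏ q ∈ n.primeFactors, (1 - (q : ℝ)⁻¹)⁻¹) ^ 2 ≤ ∏ q ∈ n.primeFactors, (1 + 6 / (q : ℝ)) := by
  rw [← Finset.prod_pow]
  refine Finset.prod_le_prod (fun q _ => sq_nonneg _) fun q hq => ?_
  have hq2 : (2 : ℝ) ≤ q := by exact_mod_cast (Nat.prime_of_mem_primeFactors hq).two_le
  have hq0 : (0 : ℝ) < q := by linarith
  have hq1 : (0 : ℝ) < q - 1 := by linarith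
  have hinv : (1 - (q : ℝ)⁻¹)⁻¹ = q / (q - 1) := by
    field_simp
  rw [hinv, div_pow, div_le_iff₀ (by positivity)]
  rw [show (1 + 6 / (q : ℝ)) * (q - 1) ^ 2 = ((q : ℝ) ^ 3 + 4 * q ^ 2 - 11 * q + 6) / q by
    field_simp; ring]
  rw [le_div_iff₀ hq0]
  nlinarith

/-- **The aggregated weight with the relative factor**: for `n ≥ 1`,
`(Σ_{dr=n}|μ(r)|·‖λ₀ⱼ(n)‖(1+‖Π(d,r)‖)/(nφ(r)))·(∏_{q∣n}(1−q⁻¹)⁻¹)² ≤ 2n⁻¹∏_{q∣n}(1+430/q)`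
(`weight_antidiagonal_le` times `relFac_le_prod`, and `(1+106/q)(1+6/q) ≤ 1+430/q`).
[cite: Zhang2022LandauSiegel, §8 display before (8.10) p.47, tex L2437] -/
theorem weight_antidiagonal_rel_le (c' : ℝ) {D : ℕ} [NeZero D] (χ : DirichletCharacter ℂ D) (j : ℕ)
    {n : ℕ} (hn : n ≠ 0) :
    (∑ p ∈ Nat.divisorsAntidiagonal n,
        ((ArithmeticFunction.moebius p.2).natAbs : ℝ) * ‖lamZero c' D j n‖ *
          (1 + ‖PiW χ p.1 p.2‖) / ((n : ℝ) * Nat.totient p.2)) *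
        (∏ q ∈ n.primeFactors, (1 - (q : ℝ)⁻¹)⁻¹) ^ 2 ≤
      2 * (∏ q ∈ n.primeFactors, (1 + 430 / (q : ℝ))) / n := by
  have hnR : (0 : ℝ) ≤ n := Nat.cast_nonneg n
  have h1 := Section8FrontEnd44Weights.weight_antidiagonal_le c' χ j hn
  have h2 := relFac_le_prod n
  calc (∑ p ∈ Nat.divisorsAntidiagonal n,
          ((ArithmeticFunction.moebius p.2).natAbs : ℝ) * ‖lamZero c' D j n‖ *
            (1 + ‖PiW χ p.1 p.2‖) / ((n : ℝ) * Nat.totient p.2)) *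
          (∏ q ∈ n.primeFactors, (1 - (q : ℝ)⁻¹)⁻¹) ^ 2
      ≤ 2 * (∏ q ∈ n.primeFactors, (1 + 106 / (q : ℝ))) / n *
          ∏ q ∈ n.primeFactors, (1 + 6 / (q : ℝ)) :=
        mul_le_mul h1 h2 (sq_nonneg _) (by positivity)
    _ = 2 * (∏ q ∈ n.primeFactors, ((1 + 106 / (q : ℝ)) * (1 + 6 / (q : ℝ)))) / n := by
        rw [Finset.prod_mul_distrib]; ring
    _ ≤ 2 * (∏ q ∈ n.primeFactors, (1 + 430 / (q : ℝ))) / n := by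
        apply div_le_div_of_nonneg_right _ hnR
        apply mul_le_mul_of_nonneg_left _ (by norm_num)
        apply Finset.prod_le_prod (fun q _ => by positivity)
        intro q hq
        have hq2 : (2 : ℝ) ≤ q := by exact_mod_cast (Nat.prime_of_mem_primeFactors hq).two_le
        have hqpos : (0 : ℝ) < q := by linarith
        rw [show (1 + 106 / (q : ℝ)) * (1 + 6 / q) = 1 + 112 / q + 636 / q ^ 2 by field_simp; ring]
        have : 636 / (q : ℝ) ^ 2 ≤ 318 / q := by
          rw [div_le_div_iff₀ (by positivity) hqpos]; nlinarith
        have : 112 / (q : ℝ) + 318 / q = 430 / q := by ring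
        linarith

/-! ## The four pointwise bookkeeping lemmas with the relative factor `Q ≥ 1` -/

/-- Range `dr < P₂/T`, relative form: `u042/u043` errors `δQ` (`Q ≥ 1`), `u040/u041` errors `δ`:
`|(M₁+ιM₂)(N₁+ῑN₂) − (A₁+ιA₂)(B₁+ῑB₂)| ≤ 18δσ·Q(1+|Π|)`. [cite: Zhang2022LandauSiegel, §8 p.47, tex L2436] -/
theorem pointwise_I_rel {ι M₁ M₂ N₁ N₂ A₁ A₂ B₁ B₂ : ℂ} {δ σ Pn Q : ℝ} (hι : ‖ι‖ ≤ 2)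
    (hM₁ : ‖M₁ - A₁‖ ≤ δ) (hM₂ : ‖M₂ - A₂‖ ≤ δ) (hN₁ : ‖N₁ - B₁‖ ≤ δ * Q) (hN₂ : ‖N₂ - B₂‖ ≤ δ * Q)
    (hA₁ : ‖A₁‖ ≤ σ) (hA₂ : ‖A₂‖ ≤ σ) (hB₁ : ‖B₁‖ ≤ σ * Pn) (hB₂ : ‖B₂‖ ≤ σ * Pn)
    (hPn : 0 ≤ Pn) (hδσ : δ ≤ σ) (hQ : 1 ≤ Q) :
    ‖(M₁ + ι * M₂) * (N₁ + conj ι * N₂) - (A₁ + ι * A₂) * (B₁ + conj ι * B₂)‖ ≤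
      18 * δ * σ * (Q * (1 + Pn)) := by
  have hδ : 0 ≤ δ := le_trans (norm_nonneg _) hM₁
  have hσ : 0 ≤ σ := hδ.trans hδσ
  have h := norm_mul_mul_sub_le hι hM₁ hM₂ hN₁ hN₂ hA₁ hA₂ hB₁ hB₂
  refine h.trans ?_
  nlinarith [mul_nonneg (mul_nonneg (mul_nonneg hδ hσ) hPn) (by linarith : (0 : ℝ) ≤ 2 * Q - 1),
    mul_nonneg (mul_nonneg hδ (sub_nonneg.mpr hδσ)) (by linarith : (0 : ℝ) ≤ Q)]

/-- Range `P₂/T ≤ dr < P₂`, relative form (`u042` error `δQ`, `Q ≥ 1`): the product differs from its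
main term by at most `(27σ² + 12σν + 12mσ + 4mν)·Q(1+|Π|)`. [cite: Zhang2022LandauSiegel, §8 p.47, tex L2436] -/
theorem pointwise_II_rel {ι M₁ M₂ N₁ N₂ A₁ A₂ B₁ B₂ : ℂ} {δ σ m ν Pn Q : ℝ} (hι : ‖ι‖ ≤ 2)
    (hM₁ : ‖M₁ - A₁‖ ≤ δ) (hN₁ : ‖N₁ - B₁‖ ≤ δ * Q) (hM₂ : ‖M₂‖ ≤ m) (hN₂ : ‖N₂‖ ≤ ν)
    (hA₁ : ‖A₁‖ ≤ σ) (hA₂ : ‖A₂‖ ≤ σ) (hB₁ : ‖B₁‖ ≤ σ * Pn) (hB₂ : ‖B₂‖ ≤ σ * Pn)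
    (hPn : 0 ≤ Pn) (hδσ : δ ≤ σ) (hQ : 1 ≤ Q) :
    ‖(M₁ + ι * M₂) * (N₁ + conj ι * N₂) - (A₁ + ι * A₂) * (B₁ + conj ι * B₂)‖ ≤
      (27 * σ ^ 2 + 12 * σ * ν + 12 * m * σ + 4 * m * ν) * (Q * (1 + Pn)) := by
  have hδ : 0 ≤ δ := le_trans (norm_nonneg _) hM₁
  have hm : 0 ≤ m := le_trans (norm_nonneg _) hM₂
  have hν : 0 ≤ ν := le_trans (norm_nonneg _) hN₂
  have hσ : 0 ≤ σ := hδ.trans hδσ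
  have hsd : 0 ≤ σ - δ := sub_nonneg.mpr hδσ
  have hM₂' : ‖M₂ - A₂‖ ≤ m + σ := (norm_sub_le _ _).trans (add_le_add hM₂ hA₂)
  have hN₂' : ‖N₂ - B₂‖ ≤ ν + σ * Pn := (norm_sub_le _ _).trans (add_le_add hN₂ hB₂)
  have h := norm_mul_mul_sub_le hι hM₁ hM₂' hN₁ hN₂' hA₁ hA₂ hB₁ hB₂
  have hX : 0 ≤ (δ + 2 * m + 2 * σ) * (5 * (σ * Pn) + 2 * ν) + 6 * σ * (ν + σ * Pn) := by
    positivity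
  have step1 : (δ + 2 * (m + σ)) * (σ * Pn + 2 * (σ * Pn) + (δ * Q + 2 * (ν + σ * Pn))) +
        (σ + 2 * σ) * (δ * Q + 2 * (ν + σ * Pn)) ≤
      Q * ((δ + 2 * (m + σ)) * (σ * Pn + 2 * (σ * Pn) + (δ + 2 * (ν + σ * Pn))) +
        (σ + 2 * σ) * (δ + 2 * (ν + σ * Pn))) := by
    nlinarith [mul_nonneg (sub_nonneg.mpr hQ) hX]
  have step2 : (δ + 2 * (m + σ)) * (σ * Pn + 2 * (σ * Pn) + (δ + 2 * (ν + σ * Pn))) +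
        (σ + 2 * σ) * (δ + 2 * (ν + σ * Pn)) ≤
      (27 * σ ^ 2 + 12 * σ * ν + 12 * m * σ + 4 * m * ν) * (1 + Pn) := by
    nlinarith [mul_nonneg hδ hsd, mul_nonneg hσ hsd, mul_nonneg hσ hσ, mul_nonneg hν hsd,
      mul_nonneg hm hsd, mul_nonneg hm hσ, mul_nonneg hσ hν, mul_nonneg hm hν,
      mul_nonneg (mul_nonneg hσ hsd) hPn, mul_nonneg (mul_nonneg hσ hσ) hPn,
      mul_nonneg (mul_nonneg hm hσ) hPn, mul_nonneg (mul_nonneg hσ hν) hPn,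
      mul_nonneg (mul_nonneg hm hν) hPn, mul_nonneg (mul_nonneg hδ hσ) hPn]
  calc ‖(M₁ + ι * M₂) * (N₁ + conj ι * N₂) - (A₁ + ι * A₂) * (B₁ + conj ι * B₂)‖
      ≤ _ := h
    _ ≤ _ := step1
    _ ≤ Q * ((27 * σ ^ 2 + 12 * σ * ν + 12 * m * σ + 4 * m * ν) * (1 + Pn)) :=
        mul_le_mul_of_nonneg_left step2 (by linarith)
    _ = (27 * σ ^ 2 + 12 * σ * ν + 12 * m * σ + 4 * m * ν) * (Q * (1 + Pn)) := by ring

/-- Range `P₂ ≤ dr < P₁/T`, relative form: `|M₁N₁ − A₁B₁| ≤ 2δσ·Q(1+|Π|)`.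
[cite: Zhang2022LandauSiegel, §8 p.47, tex L2436] -/
theorem pointwise_III_rel {M₁ N₁ A₁ B₁ : ℂ} {δ σ Pn Q : ℝ} (hM₁ : ‖M₁ - A₁‖ ≤ δ)
    (hN₁ : ‖N₁ - B₁‖ ≤ δ * Q) (hA₁ : ‖A₁‖ ≤ σ) (hB₁ : ‖B₁‖ ≤ σ * Pn) (hPn : 0 ≤ Pn)
    (hδσ : δ ≤ σ) (hQ : 1 ≤ Q) :
    ‖M₁ * N₁ - A₁ * B₁‖ ≤ 2 * δ * σ * (Q * (1 + Pn)) := by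
  have hδ : 0 ≤ δ := le_trans (norm_nonneg _) hM₁
  have hσ : 0 ≤ σ := hδ.trans hδσ
  have hδQ : 0 ≤ δ * Q := le_trans (norm_nonneg _) hN₁
  have h := norm_mul_sub_le M₁ N₁ A₁ B₁
  calc ‖M₁ * N₁ - A₁ * B₁‖
      ≤ ‖M₁ - A₁‖ * (‖B₁‖ + ‖N₁ - B₁‖) + ‖A₁‖ * ‖N₁ - B₁‖ := h
    _ ≤ δ * (σ * Pn + δ * Q) + σ * (δ * Q) :=
        add_le_add (mul_le_mul hM₁ (add_le_add hB₁ hN₁) (by positivity) hδ)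
          (mul_le_mul hA₁ hN₁ (norm_nonneg _) hσ)
    _ ≤ 2 * δ * σ * (Q * (1 + Pn)) := by
        nlinarith [mul_nonneg (mul_nonneg (mul_nonneg hδ hσ) hPn) (by linarith : (0 : ℝ) ≤ 2 * Q - 1),
          mul_nonneg (mul_nonneg hδ (sub_nonneg.mpr hδσ)) (by linarith : (0 : ℝ) ≤ Q)]

/-- Range `P₁/T ≤ dr < P₁`, relative bookkeeping form (`Q ≥ 1` only weakens the bound):
`|M₁N₁ − A₁B₁| ≤ (mν + σ²)·Q(1+|Π|)`. [cite: Zhang2022LandauSiegel, §8 p.47, tex L2436] -/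
theorem pointwise_IV_rel {M₁ N₁ A₁ B₁ : ℂ} {m ν σ Pn Q : ℝ} (hM₁ : ‖M₁‖ ≤ m) (hN₁ : ‖N₁‖ ≤ ν)
    (hA₁ : ‖A₁‖ ≤ σ) (hB₁ : ‖B₁‖ ≤ σ * Pn) (hPn : 0 ≤ Pn) (hQ : 1 ≤ Q) :
    ‖M₁ * N₁ - A₁ * B₁‖ ≤ (m * ν + σ ^ 2) * (Q * (1 + Pn)) := by
  have hm : 0 ≤ m := le_trans (norm_nonneg _) hM₁
  have hν : 0 ≤ ν := le_trans (norm_nonneg _) hN₁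
  refine (pointwise_IV hM₁ hN₁ hA₁ hB₁ hPn).trans ?_
  nlinarith [mul_nonneg (mul_nonneg (add_nonneg (mul_nonneg hm hν) (sq_nonneg σ))
    (sub_nonneg.mpr hQ)) (by linarith : (0 : ℝ) ≤ 1 + Pn)]

/-! ## The weighted sum over a range of `n = dr`, relative form -/

/-- **Range total, relative form.** If on `⌈Y⌉ ≤ n < ⌈Z⌉` (`1 ≤ Y ≤ Z`) every factorisation
`n = dr` carries an error `|Φ(d,r)| ≤ E·(∏_{q∣n}(1−q⁻¹)⁻¹)²·(1 + |Π(d,r)|)`, then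
`Σ_n Σ_{dr=n} |w_j(d,r)|·|Φ(d,r)| ≤ 2e⁴³⁰·E·(1 + log(Z/Y))`.
[cite: Zhang2022LandauSiegel, §8 p.47, tex L2436] -/
theorem range_sum_le_rel (c' : ℝ) {D : ℕ} [NeZero D] (χ : DirichletCharacter ℂ D) (j : ℕ)
    {Y Z E : ℝ} (hY : 1 ≤ Y) (hYZ : Y ≤ Z) (hE : 0 ≤ E) (Φ : ℕ × ℕ → ℂ)
    (hΦ : ∀ n ∈ Finset.Ico ⌈Y⌉₊ ⌈Z⌉₊, ∀ p ∈ Nat.divisorsAntidiagonal n,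
      ‖Φ p‖ ≤ E * ((∏ q ∈ n.primeFactors, (1 - (q : ℝ)⁻¹)⁻¹) ^ 2 * (1 + ‖PiW χ p.1 p.2‖))) :
    ∑ n ∈ Finset.Ico ⌈Y⌉₊ ⌈Z⌉₊, ∑ p ∈ Nat.divisorsAntidiagonal n,
        ‖((ArithmeticFunction.moebius p.2).natAbs : ℂ) * (‖χ ((p.1 * p.2 : ℕ) : ZMod D)‖ : ℂ) /
              (((p.1 * p.2 : ℕ) : ℂ) * (Nat.totient p.2 : ℂ)) * lamZero c' D j (p.1 * p.2)‖ * ‖Φ p‖ ≤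
      2 * Real.exp 430 * E * (1 + Real.log (Z / Y)) := by
  have hY0 : 0 < Y := by linarith
  have hinner : ∀ n ∈ Finset.Ico ⌈Y⌉₊ ⌈Z⌉₊, ∑ p ∈ Nat.divisorsAntidiagonal n,
      ‖((ArithmeticFunction.moebius p.2).natAbs : ℂ) * (‖χ ((p.1 * p.2 : ℕ) : ZMod D)‖ : ℂ) /
            (((p.1 * p.2 : ℕ) : ℂ) * (Nat.totient p.2 : ℂ)) * lamZero c' D j (p.1 * p.2)‖ * ‖Φ p‖ ≤
        (∏ q ∈ n.primeFactors, (1 + 430 / (q : ℝ))) / (n : ℝ) * (2 * E) := by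
    intro n hn
    have hn1 : 1 ≤ n :=
      (Nat.one_le_iff_ne_zero.mpr (Nat.ceil_pos.mpr hY0).ne').trans (Finset.mem_Ico.mp hn).1
    have hn0 : n ≠ 0 := by omega
    have hnR : (0 : ℝ) < n := by exact_mod_cast hn1
    set R : ℝ := (∏ q ∈ n.primeFactors, (1 - (q : ℝ)⁻¹)⁻¹) ^ 2 with hR
    have hR0 : 0 ≤ R := by rw [hR]; exact sq_nonneg _
    have hterm : ∀ p ∈ Nat.divisorsAntidiagonal n,
        ‖((ArithmeticFunction.moebius p.2).natAbs : ℂ) * (‖χ ((p.1 * p.2 : ℕ) : ZMod D)‖ : ℂ) /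
              (((p.1 * p.2 : ℕ) : ℂ) * (Nat.totient p.2 : ℂ)) * lamZero c' D j (p.1 * p.2)‖ * ‖Φ p‖ ≤
          E * ((((ArithmeticFunction.moebius p.2).natAbs : ℝ) * ‖lamZero c' D j n‖ *
            (1 + ‖PiW χ p.1 p.2‖) / ((n : ℝ) * Nat.totient p.2)) * R) := by
      intro p hp
      have hΦp := hΦ n hn p hp
      obtain ⟨hpn, -⟩ := Nat.mem_divisorsAntidiagonal.mp hp
      have hp2 : 1 ≤ p.2 := Nat.one_le_iff_ne_zero.mpr fun h => hn0 (by rw [← hpn, h, mul_zero])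
      have hφ : (0 : ℝ) < Nat.totient p.2 := by exact_mod_cast Nat.totient_pos.mpr hp2
      rw [hpn]
      have hw : ‖((ArithmeticFunction.moebius p.2).natAbs : ℂ) * (‖χ (n : ZMod D)‖ : ℂ) /
            ((n : ℂ) * (Nat.totient p.2 : ℂ)) * lamZero c' D j n‖ ≤
          ((ArithmeticFunction.moebius p.2).natAbs : ℝ) / ((n : ℝ) * Nat.totient p.2) *
            ‖lamZero c' D j n‖ := by
        rw [norm_mul, norm_div, norm_mul, norm_mul, Complex.norm_natCast, Complex.norm_real,
          Real.norm_of_nonneg (norm_nonneg _), Complex.norm_natCast, Complex.norm_natCast]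
        apply mul_le_mul_of_nonneg_right _ (norm_nonneg _)
        apply div_le_div_of_nonneg_right _ (by positivity)
        exact mul_le_of_le_one_right (by positivity) (DirichletCharacter.norm_le_one χ _)
      calc ‖((ArithmeticFunction.moebius p.2).natAbs : ℂ) * (‖χ (n : ZMod D)‖ : ℂ) /
              ((n : ℂ) * (Nat.totient p.2 : ℂ)) * lamZero c' D j n‖ * ‖Φ p‖
          ≤ (((ArithmeticFunction.moebius p.2).natAbs : ℝ) / ((n : ℝ) * Nat.totient p.2) *
              ‖lamZero c' D j n‖) * (E * (R * (1 + ‖PiW χ p.1 p.2‖))) :=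
            mul_le_mul hw hΦp (norm_nonneg _) (by positivity)
        _ = E * ((((ArithmeticFunction.moebius p.2).natAbs : ℝ) * ‖lamZero c' D j n‖ *
              (1 + ‖PiW χ p.1 p.2‖) / ((n : ℝ) * Nat.totient p.2)) * R) := by ring
    calc ∑ p ∈ Nat.divisorsAntidiagonal n,
          ‖((ArithmeticFunction.moebius p.2).natAbs : ℂ) * (‖χ ((p.1 * p.2 : ℕ) : ZMod D)‖ : ℂ) /
                (((p.1 * p.2 : ℕ) : ℂ) * (Nat.totient p.2 : ℂ)) * lamZero c' D j (p.1 * p.2)‖ * ‖Φ p‖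
        ≤ ∑ p ∈ Nat.divisorsAntidiagonal n,
            E * ((((ArithmeticFunction.moebius p.2).natAbs : ℝ) * ‖lamZero c' D j n‖ *
              (1 + ‖PiW χ p.1 p.2‖) / ((n : ℝ) * Nat.totient p.2)) * R) := Finset.sum_le_sum hterm
      _ = E * ((∑ p ∈ Nat.divisorsAntidiagonal n,
            ((ArithmeticFunction.moebius p.2).natAbs : ℝ) * ‖lamZero c' D j n‖ *
              (1 + ‖PiW χ p.1 p.2‖) / ((n : ℝ) * Nat.totient p.2)) * R) := by
          rw [Finset.sum_mul, Finset.mul_sum]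
      _ ≤ E * (2 * (∏ q ∈ n.primeFactors, (1 + 430 / (q : ℝ))) / n) :=
          mul_le_mul_of_nonneg_left (by rw [hR]; exact weight_antidiagonal_rel_le c' χ j hn0) hE
      _ = (∏ q ∈ n.primeFactors, (1 + 430 / (q : ℝ))) / (n : ℝ) * (2 * E) := by ring
  calc ∑ n ∈ Finset.Ico ⌈Y⌉₊ ⌈Z⌉₊, ∑ p ∈ Nat.divisorsAntidiagonal n,
        ‖((ArithmeticFunction.moebius p.2).natAbs : ℂ) * (‖χ ((p.1 * p.2 : ℕ) : ZMod D)‖ : ℂ) /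
              (((p.1 * p.2 : ℕ) : ℂ) * (Nat.totient p.2 : ℂ)) * lamZero c' D j (p.1 * p.2)‖ * ‖Φ p‖
      ≤ ∑ n ∈ Finset.Ico ⌈Y⌉₊ ⌈Z⌉₊, (∏ q ∈ n.primeFactors, (1 + 430 / (q : ℝ))) / (n : ℝ) * (2 * E) :=
        Finset.sum_le_sum hinner
    _ ≤ Real.exp 430 * (2 * E) * (1 + Real.log (Z / Y)) :=
        Section8FrontEnd44Moments.sum_Ico_prod_one_add_div_mul_le (c := 430) (by norm_num) hY hYZ
          (g := fun _ => 2 * E) (G := 2 * E) (fun _ => by positivity) (fun _ _ => le_rfl)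
    _ = 2 * Real.exp 430 * E * (1 + Real.log (Z / Y)) := by ring

/-! ## The relative twins of `Z22:§8.u042`, `Z22:§8.u043` (L2 LEDGER #12 (R45)) -/

/-- **`Z22:§8.u042` with an error weight `W(dr)` ⇐ Lemma 8.4 with the same weight** (`W ≥ 0`):
seat d20's `Section8FrontEnd84.step8u042_of_lemma84` with the factor `W(dr)` threaded through
(`μ = 6`, `y = P₁/dr`, (8.6), `β̄₆ = −β₆`; constant `2|C|`). With `W(n) = (∏_{q∣n}(1−q⁻¹)⁻¹)²` the
hypothesis is literally `Skeleton.Lemma84Rel c′`. [cite: Zhang2022LandauSiegel, §8 p.47, tex L2429] -/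
theorem u042R_of_lemma84W (c' : ℝ) {W : ℕ → ℝ} (hW : ∀ n, 0 ≤ W n)
    (h84 : ∃ C : ℝ, ForAllLarge fun D _ χ => AssumptionA D χ →
      ∀ j ∈ ({1, 2, 3} : Finset ℕ), ∀ μ ∈ ({6, 7} : Finset ℕ), ∀ d r : ℕ, 1 ≤ d → 1 ≤ r →
        ((d * r : ℕ) : ℝ) < bigP D / bigT D ^ 2 → ∀ y : ℝ, bigT D < y → y < bigP D →
          ‖(∑ n ∈ Finset.Ico 1 ⌈y⌉₊, χ (n : ZMod D) * xiZero c' D j n d r / (n : ℂ) *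
                ((y / n : ℝ) : ℂ) ^ (-betaMu D μ) * (Real.log (y / n) : ℂ)) -
              deriv χ.LFunction 1 * PiW χ d r * frakgW c' D j μ y‖ ≤
            C * (ell D ^ 6)⁻¹ * W (d * r)) :
    ∃ C : ℝ, ForAllLarge fun D _ χ => AssumptionA D χ →
      ∀ j ∈ ({1, 2, 3} : Finset ℕ), ∀ d r : ℕ, 1 ≤ d → 1 ≤ r →
        ((d * r : ℕ) : ℝ) < Skeleton.P1 D / bigT D →
          ‖(∑ n ∈ Finset.Ico 1 (Nsupp D),
                χ (n : ZMod D) * conj (vk1 D (d * r * n)) * xiZero c' D j n d r / (n : ℂ)) -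
              deriv χ.LFunction 1 * PiW χ d r / (Real.log (Skeleton.P1 D) : ℂ) *
                frakgW c' D j 6 (Skeleton.P1 D / ((d * r : ℕ) : ℝ))‖ ≤
            C * (ell D ^ 15)⁻¹ * W (d * r) := by
  obtain ⟨C, D₀, h⟩ := h84
  refine ⟨2 * |C|, max D₀ ⌈Real.exp 2⌉₊, fun D _ χ hD hq hp hA j hj d r hd hr hdr => ?_⟩
  have hD₀ : D₀ ≤ D := le_trans (le_max_left _ _) hD
  have hL : 2 ≤ ell D := two_le_ell (le_trans (le_max_right _ _) hD)
  obtain ⟨hlogP1, -, hP1PT, -, hP1T, -, hP1P, -⟩ := params hL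
  have hL0 : 0 < ell D := by linarith
  have hT0 : 0 < bigT D := Real.exp_pos _
  have hdr1 : 1 ≤ d * r := Nat.one_le_iff_ne_zero.mpr (Nat.mul_ne_zero (by omega) (by omega))
  have hdr0 : (0 : ℝ) < ((d * r : ℕ) : ℝ) := by exact_mod_cast hdr1
  set x : ℝ := Skeleton.P1 D / ((d * r : ℕ) : ℝ) with hx
  have hP1x : Skeleton.P1 D = ((d * r : ℕ) : ℝ) * x := by rw [hx]; field_simp
  have hxT : bigT D < x := by
    rw [hx, lt_div_iff₀ hdr0]; rw [lt_div_iff₀ hT0] at hdr; linarith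
  have hP1pos : 0 < Skeleton.P1 D := Real.rpow_pos_of_pos (Real.exp_pos _) _
  have hxle : x ≤ Skeleton.P1 D := div_le_self hP1pos.le (by exact_mod_cast hdr1)
  have hxP : x < bigP D := lt_of_le_of_lt hxle hP1P
  have hT1 : 1 < bigT D := by
    rw [bigT]; exact Real.one_lt_exp_iff.mpr (by positivity)
  have hP1one : 1 < Skeleton.P1 D := lt_of_lt_of_le (lt_trans hT1 hxT) hxle
  have hdrPT : ((d * r : ℕ) : ℝ) < bigP D / bigT D ^ 2 := by
    have : Skeleton.P1 D / bigT D ≤ bigP D / bigT D ^ 2 := by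
      rw [div_le_div_iff₀ hT0 (by positivity)]; nlinarith
    exact lt_of_lt_of_le hdr this
  have key := h D χ hD₀ hq hp hA j hj 6 (by simp) d r hd hr hdrPT x hxT hxP
  have hWdr : 0 ≤ W (d * r) := hW _
  have key' : ‖(∑ n ∈ Finset.Ico 1 ⌈x⌉₊, χ (n : ZMod D) * xiZero c' D j n d r / (n : ℂ) *
        ((x / n : ℝ) : ℂ) ^ (-betaMu D 6) * (Real.log (x / n) : ℂ)) -
          deriv χ.LFunction 1 * PiW χ d r * frakgW c' D j 6 x‖ ≤
      |C| * (ell D ^ 6)⁻¹ * W (d * r) := by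
    refine key.trans ?_
    have hℓ : 0 ≤ (ell D ^ 6)⁻¹ := by positivity
    gcongr
    exact le_abs_self _
  have hsub : Finset.Ico 1 ⌈x⌉₊ ⊆ Finset.Ico 1 (Nsupp D) := Ico_ceil_subset hP1PT hdr1
  have hsum : (∑ n ∈ Finset.Ico 1 (Nsupp D),
        χ (n : ZMod D) * conj (vk1 D (d * r * n)) * xiZero c' D j n d r / (n : ℂ)) =
      (1 / (Real.log (Skeleton.P1 D) : ℂ)) *
        ∑ n ∈ Finset.Ico 1 ⌈x⌉₊, χ (n : ZMod D) * xiZero c' D j n d r / (n : ℂ) *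
          ((x / n : ℝ) : ℂ) ^ (-betaMu D 6) * (Real.log (x / n) : ℂ) := by
    rw [Finset.mul_sum]
    symm
    apply Finset.sum_subset_zero_on_sdiff hsub
    · intro n hn
      rw [Finset.mem_sdiff, Finset.mem_Ico, Finset.mem_Ico, not_and, not_lt] at hn
      have hxn : x ≤ n := Nat.ceil_le.mp (hn.2 hn.1.1)
      have : Skeleton.P1 D ≤ ((d * r * n : ℕ) : ℝ) := by
        rw [hP1x]; push_cast
        exact mul_le_mul_of_nonneg_left hxn (by positivity)
      rw [vk1_mul_eq_zero this, map_zero, mul_zero, zero_mul, zero_div]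
    · intro n hn
      rw [Finset.mem_Ico] at hn
      have hn1 : 1 ≤ n := hn.1
      have hnx : (n : ℝ) < x := Nat.lt_ceil.mp hn.2
      have hn0 : (0 : ℝ) < n := by exact_mod_cast hn1
      have hdrn : ((d * r * n : ℕ) : ℝ) < Skeleton.P1 D := by
        rw [hP1x]; push_cast
        have := mul_lt_mul_of_pos_left hnx hdr0
        push_cast at this; linarith
      rw [conj_vk1_mul_eq hP1one hdr1 hn1 hdrn]
      have hb : betaMu D 6 = beta6 D := by simp [betaMu]
      rw [hb, show Skeleton.P1 D / ((d * r : ℕ) : ℝ) / n = x / n by rw [hx]]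
      ring
  have hlog0 : 0 < Real.log (Skeleton.P1 D) := by rw [hlogP1]; positivity
  rw [hsum, show (1 / (Real.log (Skeleton.P1 D) : ℂ)) *
        (∑ n ∈ Finset.Ico 1 ⌈x⌉₊, χ (n : ZMod D) * xiZero c' D j n d r / (n : ℂ) *
          ((x / n : ℝ) : ℂ) ^ (-betaMu D 6) * (Real.log (x / n) : ℂ)) -
        deriv χ.LFunction 1 * PiW χ d r / (Real.log (Skeleton.P1 D) : ℂ) * frakgW c' D j 6 x =
      (1 / (Real.log (Skeleton.P1 D) : ℂ)) *
        ((∑ n ∈ Finset.Ico 1 ⌈x⌉₊, χ (n : ZMod D) * xiZero c' D j n d r / (n : ℂ) *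
          ((x / n : ℝ) : ℂ) ^ (-betaMu D 6) * (Real.log (x / n) : ℂ)) -
          deriv χ.LFunction 1 * PiW χ d r * frakgW c' D j 6 x) by ring, norm_mul]
  have hn : ‖(1 / (Real.log (Skeleton.P1 D) : ℂ))‖ = 1 / Real.log (Skeleton.P1 D) := by
    rw [norm_div, norm_one, Complex.norm_real, Real.norm_eq_abs, abs_of_pos hlog0]
  rw [hn]
  have hC0 : 0 ≤ |C| := abs_nonneg _
  calc 1 / Real.log (Skeleton.P1 D) * ‖(∑ n ∈ Finset.Ico 1 ⌈x⌉₊,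
          χ (n : ZMod D) * xiZero c' D j n d r / (n : ℂ) * ((x / n : ℝ) : ℂ) ^ (-betaMu D 6) *
            (Real.log (x / n) : ℂ)) - deriv χ.LFunction 1 * PiW χ d r * frakgW c' D j 6 x‖
      ≤ 1 / Real.log (Skeleton.P1 D) * (|C| * (ell D ^ 6)⁻¹ * W (d * r)) :=
        mul_le_mul_of_nonneg_left key' (by positivity)
    _ = |C| / 0.504 * (ell D ^ 15)⁻¹ * W (d * r) := by rw [hlogP1]; field_simp
    _ ≤ 2 * |C| * (ell D ^ 15)⁻¹ * W (d * r) := by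
        apply mul_le_mul_of_nonneg_right _ hWdr
        apply mul_le_mul_of_nonneg_right _ (by positivity)
        rw [div_le_iff₀ (by norm_num)]; nlinarith

/-- **`Z22:§8.u043` with an error weight `W(dr)` ⇐ Lemma 8.4 with the same weight** (`W ≥ 0`):
seat d20's `Section8FrontEnd84.step8u043_of_lemma84` with the factor `W(dr)` threaded through
(`μ = 7`, `y = P₂/dr`, (8.6), `β̄₇ = −β₇`, `log P₂ ≥ 𝓛⁹/4`; constant `4|C|`).
[cite: Zhang2022LandauSiegel, §8 p.47, tex L2433] -/
theorem u043R_of_lemma84W (c' : ℝ) {W : ℕ → ℝ} (hW : ∀ n, 0 ≤ W n)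
    (h84 : ∃ C : ℝ, ForAllLarge fun D _ χ => AssumptionA D χ →
      ∀ j ∈ ({1, 2, 3} : Finset ℕ), ∀ μ ∈ ({6, 7} : Finset ℕ), ∀ d r : ℕ, 1 ≤ d → 1 ≤ r →
        ((d * r : ℕ) : ℝ) < bigP D / bigT D ^ 2 → ∀ y : ℝ, bigT D < y → y < bigP D →
          ‖(∑ n ∈ Finset.Ico 1 ⌈y⌉₊, χ (n : ZMod D) * xiZero c' D j n d r / (n : ℂ) *
                ((y / n : ℝ) : ℂ) ^ (-betaMu D μ) * (Real.log (y / n) : ℂ)) -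
              deriv χ.LFunction 1 * PiW χ d r * frakgW c' D j μ y‖ ≤
            C * (ell D ^ 6)⁻¹ * W (d * r)) :
    ∃ C : ℝ, ForAllLarge fun D _ χ => AssumptionA D χ →
      ∀ j ∈ ({1, 2, 3} : Finset ℕ), ∀ d r : ℕ, 1 ≤ d → 1 ≤ r →
        ((d * r : ℕ) : ℝ) < Skeleton.P2 D / bigT D →
          ‖(∑ n ∈ Finset.Ico 1 (Nsupp D),
                χ (n : ZMod D) * conj (vk2 D (d * r * n)) * xiZero c' D j n d r / (n : ℂ)) -
              deriv χ.LFunction 1 * PiW χ d r / (Real.log (Skeleton.P2 D) : ℂ) *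
                frakgW c' D j 7 (Skeleton.P2 D / ((d * r : ℕ) : ℝ))‖ ≤
            C * (ell D ^ 15)⁻¹ * W (d * r) := by
  obtain ⟨C, D₀, h⟩ := h84
  refine ⟨4 * |C|, max D₀ ⌈Real.exp 2⌉₊, fun D _ χ hD hq hp hA j hj d r hd hr hdr => ?_⟩
  have hD₀ : D₀ ≤ D := le_trans (le_max_left _ _) hD
  have hL : 2 ≤ ell D := two_le_ell (le_trans (le_max_right _ _) hD)
  obtain ⟨-, hlogP2, -, hP2PT, -, hP2T, -, hP2P⟩ := params hL
  have hL0 : 0 < ell D := by linarith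
  have hT0 : 0 < bigT D := Real.exp_pos _
  have hdr1 : 1 ≤ d * r := Nat.one_le_iff_ne_zero.mpr (Nat.mul_ne_zero (by omega) (by omega))
  have hdr0 : (0 : ℝ) < ((d * r : ℕ) : ℝ) := by exact_mod_cast hdr1
  set x : ℝ := Skeleton.P2 D / ((d * r : ℕ) : ℝ) with hx
  have hP2x : Skeleton.P2 D = ((d * r : ℕ) : ℝ) * x := by rw [hx]; field_simp
  have hxT : bigT D < x := by
    rw [hx, lt_div_iff₀ hdr0]; rw [lt_div_iff₀ hT0] at hdr; linarith
  have hP2pos : 0 < Skeleton.P2 D :=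
    div_pos (Real.rpow_pos_of_pos (Real.exp_pos _) _) (pow_pos (Real.exp_pos _) _)
  have hxle : x ≤ Skeleton.P2 D := div_le_self hP2pos.le (by exact_mod_cast hdr1)
  have hxP : x < bigP D := lt_of_le_of_lt hxle hP2P
  have hT1 : 1 < bigT D := by
    rw [bigT]; exact Real.one_lt_exp_iff.mpr (by positivity)
  have hP2one : 1 < Skeleton.P2 D := lt_of_lt_of_le (lt_trans hT1 hxT) hxle
  have hdrPT : ((d * r : ℕ) : ℝ) < bigP D / bigT D ^ 2 := by
    have : Skeleton.P2 D / bigT D ≤ bigP D / bigT D ^ 2 := by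
      rw [div_le_div_iff₀ hT0 (by positivity)]; nlinarith
    exact lt_of_lt_of_le hdr this
  have key := h D χ hD₀ hq hp hA j hj 7 (by simp) d r hd hr hdrPT x hxT hxP
  have hWdr : 0 ≤ W (d * r) := hW _
  have key' : ‖(∑ n ∈ Finset.Ico 1 ⌈x⌉₊, χ (n : ZMod D) * xiZero c' D j n d r / (n : ℂ) *
        ((x / n : ℝ) : ℂ) ^ (-betaMu D 7) * (Real.log (x / n) : ℂ)) -
          deriv χ.LFunction 1 * PiW χ d r * frakgW c' D j 7 x‖ ≤
      |C| * (ell D ^ 6)⁻¹ * W (d * r) := by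
    refine key.trans ?_
    have hℓ : 0 ≤ (ell D ^ 6)⁻¹ := by positivity
    gcongr
    exact le_abs_self _
  have hsub : Finset.Ico 1 ⌈x⌉₊ ⊆ Finset.Ico 1 (Nsupp D) := Ico_ceil_subset hP2PT hdr1
  have hsum : (∑ n ∈ Finset.Ico 1 (Nsupp D),
        χ (n : ZMod D) * conj (vk2 D (d * r * n)) * xiZero c' D j n d r / (n : ℂ)) =
      (1 / (Real.log (Skeleton.P2 D) : ℂ)) *
        ∑ n ∈ Finset.Ico 1 ⌈x⌉₊, χ (n : ZMod D) * xiZero c' D j n d r / (n : ℂ) *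
          ((x / n : ℝ) : ℂ) ^ (-betaMu D 7) * (Real.log (x / n) : ℂ) := by
    rw [Finset.mul_sum]
    symm
    apply Finset.sum_subset_zero_on_sdiff hsub
    · intro n hn
      rw [Finset.mem_sdiff, Finset.mem_Ico, Finset.mem_Ico, not_and, not_lt] at hn
      have hxn : x ≤ n := Nat.ceil_le.mp (hn.2 hn.1.1)
      have : Skeleton.P2 D ≤ ((d * r * n : ℕ) : ℝ) := by
        rw [hP2x]; push_cast
        exact mul_le_mul_of_nonneg_left hxn (by positivity)
      rw [vk2_mul_eq_zero this, map_zero, mul_zero, zero_mul, zero_div]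
    · intro n hn
      rw [Finset.mem_Ico] at hn
      have hn1 : 1 ≤ n := hn.1
      have hnx : (n : ℝ) < x := Nat.lt_ceil.mp hn.2
      have hn0 : (0 : ℝ) < n := by exact_mod_cast hn1
      have hdrn : ((d * r * n : ℕ) : ℝ) < Skeleton.P2 D := by
        rw [hP2x]; push_cast
        have := mul_lt_mul_of_pos_left hnx hdr0
        push_cast at this; linarith
      rw [conj_vk2_mul_eq hP2one hdr1 hn1 hdrn]
      have hb : betaMu D 7 = beta7 D := by simp [betaMu]
      rw [hb, show Skeleton.P2 D / ((d * r : ℕ) : ℝ) / n = x / n by rw [hx]]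
      ring
  have hlog0 : 0 < Real.log (Skeleton.P2 D) := lt_of_lt_of_le (by positivity) hlogP2
  rw [hsum, show (1 / (Real.log (Skeleton.P2 D) : ℂ)) *
        (∑ n ∈ Finset.Ico 1 ⌈x⌉₊, χ (n : ZMod D) * xiZero c' D j n d r / (n : ℂ) *
          ((x / n : ℝ) : ℂ) ^ (-betaMu D 7) * (Real.log (x / n) : ℂ)) -
        deriv χ.LFunction 1 * PiW χ d r / (Real.log (Skeleton.P2 D) : ℂ) * frakgW c' D j 7 x =
      (1 / (Real.log (Skeleton.P2 D) : ℂ)) *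
        ((∑ n ∈ Finset.Ico 1 ⌈x⌉₊, χ (n : ZMod D) * xiZero c' D j n d r / (n : ℂ) *
          ((x / n : ℝ) : ℂ) ^ (-betaMu D 7) * (Real.log (x / n) : ℂ)) -
          deriv χ.LFunction 1 * PiW χ d r * frakgW c' D j 7 x) by ring, norm_mul]
  have hn : ‖(1 / (Real.log (Skeleton.P2 D) : ℂ))‖ = 1 / Real.log (Skeleton.P2 D) := by
    rw [norm_div, norm_one, Complex.norm_real, Real.norm_eq_abs, abs_of_pos hlog0]
  rw [hn]
  have hL9 : 0 < ell D ^ 9 := by positivity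
  have hinv : 1 / Real.log (Skeleton.P2 D) ≤ 4 / ell D ^ 9 := by
    rw [div_le_div_iff₀ hlog0 hL9]; linarith
  have hC0 : 0 ≤ |C| := abs_nonneg _
  calc 1 / Real.log (Skeleton.P2 D) * ‖(∑ n ∈ Finset.Ico 1 ⌈x⌉₊,
          χ (n : ZMod D) * xiZero c' D j n d r / (n : ℂ) * ((x / n : ℝ) : ℂ) ^ (-betaMu D 7) *
            (Real.log (x / n) : ℂ)) - deriv χ.LFunction 1 * PiW χ d r * frakgW c' D j 7 x‖
      ≤ 4 / ell D ^ 9 * (|C| * (ell D ^ 6)⁻¹ * W (d * r)) :=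
        mul_le_mul hinv key' (norm_nonneg _) (by positivity)
    _ = 4 * |C| * (ell D ^ 15)⁻¹ * W (d * r) := by field_simp

/-! ## The reduction, relative form, for fixed `D`, `χ`, `j` -/

set_option maxHeartbeats 400000 in
/-- **Core estimate, RELATIVE form** (the `u042/u043` errors carry the factor `(∏_{q∣dr}(1−q⁻¹)⁻¹)²`
of `Skeleton.Lemma84Rel`; otherwise verbatim `Section8FrontEnd44Reduction.core`, with the weight
constant `e⁴³⁰` in place of `e¹⁰⁶`). **Core estimate of the "simple approximation" `Z22:§8.u044`.** For constants `C₁, C₂ ≥ 0` there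
is `K = K(c′, C₁, C₂)` such that: for every `D ≥ ⌈e³⌉`, real primitive `χ (mod D)` and `j`, if the
four applications `§8.u040`–`u043` hold at this `D, χ, j` with error `C₁𝓛⁻¹⁵` (ranges `dr < P_k/T`)
and the tail mean `Σ_{n<x}|ξ₀ⱼ(n;d,r)|/n ≤ C₂𝓛(1 + log x)³` (`x ≤ T`) holds, then `S_j(𝐚₁₁,𝐚₂₁)`
differs from the right side of the gathering display by at most `K(log T)⁷𝓛⁻¹⁷`
(`log T = 𝓛^{1.1}`, so this is `K𝓛^{-9.3} = o(α)`). [cite: Zhang2022LandauSiegel, §8 p.47, tex L2436] -/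
theorem coreRel (c' : ℝ) {C₁ C₂ : ℝ} (hC₁ : 0 ≤ C₁) (hC₂ : 0 ≤ C₂) :
    ∃ K : ℝ, 0 ≤ K ∧ ∀ {D : ℕ} [NeZero D] {χ : DirichletCharacter ℂ D}, χ.IsQuadratic →
      χ.IsPrimitive → ⌈Real.exp 3⌉₊ ≤ D → ∀ j : ℕ,
      (∀ d r : ℕ, 1 ≤ d → 1 ≤ r → ((d * r : ℕ) : ℝ) < Skeleton.P1 D / bigT D →
        ‖(∑ m ∈ Finset.Ico 1 (Nsupp D),
              χ (m : ZMod D) * vk1 D (d * r * m) / (m : ℂ) ^ (1 - betaJ c' D j)) -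
            deriv χ.LFunction 1 / (Real.log (Skeleton.P1 D) : ℂ) *
              frakfW c' D j 6 (Skeleton.P1 D / ((d * r : ℕ) : ℝ))‖ ≤ C₁ / ell D ^ 15) →
      (∀ d r : ℕ, 1 ≤ d → 1 ≤ r → ((d * r : ℕ) : ℝ) < Skeleton.P2 D / bigT D →
        ‖(∑ m ∈ Finset.Ico 1 (Nsupp D),
              χ (m : ZMod D) * vk2 D (d * r * m) / (m : ℂ) ^ (1 - betaJ c' D j)) -
            deriv χ.LFunction 1 / (Real.log (Skeleton.P2 D) : ℂ) *
              frakfW c' D j 7 (Skeleton.P2 D / ((d * r : ℕ) : ℝ))‖ ≤ C₁ / ell D ^ 15) →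
      (∀ d r : ℕ, 1 ≤ d → 1 ≤ r → ((d * r : ℕ) : ℝ) < Skeleton.P1 D / bigT D →
        ‖(∑ n ∈ Finset.Ico 1 (Nsupp D),
              χ (n : ZMod D) * conj (vk1 D (d * r * n)) * xiZero c' D j n d r / (n : ℂ)) -
            deriv χ.LFunction 1 * PiW χ d r / (Real.log (Skeleton.P1 D) : ℂ) *
              frakgW c' D j 6 (Skeleton.P1 D / ((d * r : ℕ) : ℝ))‖ ≤
          C₁ / ell D ^ 15 * (∏ q ∈ (d * r).primeFactors, (1 - (q : ℝ)⁻¹)⁻¹) ^ 2) →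
      (∀ d r : ℕ, 1 ≤ d → 1 ≤ r → ((d * r : ℕ) : ℝ) < Skeleton.P2 D / bigT D →
        ‖(∑ n ∈ Finset.Ico 1 (Nsupp D),
              χ (n : ZMod D) * conj (vk2 D (d * r * n)) * xiZero c' D j n d r / (n : ℂ)) -
            deriv χ.LFunction 1 * PiW χ d r / (Real.log (Skeleton.P2 D) : ℂ) *
              frakgW c' D j 7 (Skeleton.P2 D / ((d * r : ℕ) : ℝ))‖ ≤
          C₁ / ell D ^ 15 * (∏ q ∈ (d * r).primeFactors, (1 - (q : ℝ)⁻¹)⁻¹) ^ 2) →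
      (∀ d r : ℕ, 1 ≤ d → 1 ≤ r → ((d * r : ℕ) : ℝ) < Skeleton.P1 D → ∀ x : ℝ, 1 ≤ x →
        x ≤ bigT D → ∑ n ∈ Finset.Ico 1 ⌈x⌉₊, ‖xiZero c' D j n d r‖ / n ≤
          C₂ * ell D * (1 + Real.log x) ^ 3) →
      ‖Sj c' D j (a11 χ) (a21 χ) -
          (deriv χ.LFunction 1 ^ 2 *
              (∑ n ∈ Finset.Ico 1 ⌈Skeleton.P2 D⌉₊, ∑ p ∈ Nat.divisorsAntidiagonal n,
                Section8cStatements.arithW c' χ j p.1 p.2 *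
                  (Section8cStatements.mFac c' D j n * Section8cStatements.nFac c' D j n)) +
            deriv χ.LFunction 1 ^ 2 *
              (∑ n ∈ Finset.Ico ⌈Skeleton.P2 D⌉₊ ⌈Skeleton.P1 D⌉₊, ∑ p ∈ Nat.divisorsAntidiagonal n,
                Section8cStatements.arithW c' χ j p.1 p.2 * Section8cStatements.diagFac c' D j n))‖ ≤
        K * (ell D ^ (1.1 : ℝ)) ^ 7 / ell D ^ 17 := by
  obtain ⟨F₀, hF₀⟩ : ∃ F₀ : ℝ, F₀ = 1 + (5.5 + 60 * |c'|) * π := ⟨_, rfl⟩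
  obtain ⟨G₀, hG₀⟩ : ∃ G₀ : ℝ, G₀ = 1 + 8 * (1 + 20 * |c'|) ^ 2 + (5.5 + 60 * |c'|) ^ 2 * π :=
    ⟨_, rfl⟩
  have hF₀0 : 0 ≤ F₀ := by rw [hF₀]; positivity
  have hG₀0 : 0 ≤ G₀ := by rw [hG₀]; positivity
  obtain ⟨S, hS⟩ : ∃ S : ℝ, S = 16 * Real.exp (9 / 2) * (F₀ + G₀) + C₁ + 1 := ⟨_, rfl⟩
  have hS0 : 0 ≤ S := by rw [hS]; positivity
  have hC₁S : C₁ ≤ S := by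
    rw [hS]; have : 0 ≤ 16 * Real.exp (9 / 2) * (F₀ + G₀) := by positivity
    linarith
  refine ⟨Real.exp 430 * (80 * C₁ * S + 112 * S ^ 2 + 1536 * S * C₂ + 384 * S + 5120 * C₂),
    by positivity, ?_⟩
  intro D _ χ hq hχ hD3 j h40 h41 h42 h43 hξ
  -- parameters
  have hL3 : 3 ≤ ell D := three_le_ell hD3
  have hD3' : 3 ≤ D := three_le_of_ceil hD3
  have hL2 : 2 ≤ ell D := by linarith
  have hL1 : 1 ≤ ell D := by linarith
  have hL0 : 0 < ell D := by linarith
  obtain ⟨hlogP1, hlogP2, hP1PT, -, -, -, hP1P, hP2P⟩ := params hL2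
  obtain ⟨hTP2, hP2TP1, hlogT, hLτ, hT1⟩ := params2 hL2
  have hL' : ‖deriv χ.LFunction 1‖ ≤ 4 * Real.exp (9 / 2) * ell D ^ 2 :=
    norm_deriv_LFunction_one_le χ hχ hL3
  have hι : ‖iota2‖ ≤ 2 := norm_iota2_le_two
  set τ : ℝ := ell D ^ (1.1 : ℝ) with hτdef
  have hτ1 : 1 ≤ τ := hL1.trans hLτ
  have hτ0 : 0 < τ := by linarith
  have hT0 : 0 < bigT D := by linarith
  have hP2pos : 0 < Skeleton.P2 D := by linarith
  have hP2one : 1 < Skeleton.P2 D := lt_of_lt_of_le hT1 hTP2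
  have hP1pos : 0 < Skeleton.P1 D := lt_of_lt_of_le (mul_pos hP2pos hT0) hP2TP1
  have hP2P1T : Skeleton.P2 D ≤ Skeleton.P1 D / bigT D := (le_div_iff₀ hT0).mpr hP2TP1
  have hP1TP1 : Skeleton.P1 D / bigT D ≤ Skeleton.P1 D := div_le_self hP1pos.le hT1.le
  have hP2TP2 : Skeleton.P2 D / bigT D ≤ Skeleton.P2 D := div_le_self hP2pos.le hT1.le
  have hP2T1 : 1 ≤ Skeleton.P2 D / bigT D := (one_le_div hT0).mpr hTP2
  have hP2P1 : Skeleton.P2 D ≤ Skeleton.P1 D := hP2P1T.trans hP1TP1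
  have hlogP1' : ell D ^ 9 / 4 ≤ Real.log (Skeleton.P1 D) := by
    rw [hlogP1]; nlinarith [pow_pos hL0 9]
  have hlogP1pos : 0 < Real.log (Skeleton.P1 D) := lt_of_lt_of_le (by positivity) hlogP1'
  have hlogP2pos : 0 < Real.log (Skeleton.P2 D) := lt_of_lt_of_le (by positivity) hlogP2
  have hlogP : Real.log (bigP D) = ell D ^ 9 := by rw [bigP, Real.log_exp]
  -- scales
  have hsc := scales (L := ell D) (τ := τ) (S := S) hL1 hLτ hS0 hC₁ hC₂
  set δ : ℝ := C₁ / ell D ^ 15 with hδ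
  set σ : ℝ := S / ell D ^ 7 with hσ
  set m : ℝ := 8 * τ ^ 2 / ell D ^ 9 with hm
  set ν : ℝ := 32 * C₂ * τ ^ 4 / ell D ^ 8 with hν
  rw [mul_div_assoc]
  set u : ℝ := τ ^ 7 / ell D ^ 17 with hu
  obtain ⟨s1, s2, s3, s4, s5⟩ := hsc
  have hδ0 : 0 ≤ δ := by rw [hδ]; positivity
  have hσ0 : 0 ≤ σ := by rw [hσ]; positivity
  have hm0 : 0 ≤ m := by rw [hm]; positivity
  have hν0 : 0 ≤ ν := by rw [hν]; positivity
  have hu0 : 0 ≤ u := by rw [hu]; positivity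
  have hδσ : δ ≤ σ := by
    rw [hδ, hσ]
    exact div_le_div₀ hS0 hC₁S (by positivity) (pow_le_pow_right₀ hL1 (by norm_num))
  have hδσ0 : 0 ≤ δ * σ := mul_nonneg hδ0 hσ0
  have hσν0 : 0 ≤ σ * ν := mul_nonneg hσ0 hν0
  have hmσ0 : 0 ≤ m * σ := mul_nonneg hm0 hσ0
  have hmν0 : 0 ≤ m * ν := mul_nonneg hm0 hν0
  have hσσ0 : 0 ≤ σ ^ 2 := sq_nonneg σ
  have hEI0 : 0 ≤ 18 * δ * σ := by linarith
  have hEII0 : 0 ≤ 27 * σ ^ 2 + 12 * σ * ν + 12 * m * σ + 4 * m * ν := by linarith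
  have hEIII0 : 0 ≤ 2 * δ * σ := by linarith
  have hEIV0 : 0 ≤ m * ν + σ ^ 2 := by linarith
  have he430 : 0 ≤ 2 * Real.exp 430 := by positivity
  have hσF : 4 * Real.exp (9 / 2) * ell D ^ 2 * F₀ / (ell D ^ 9 / 4) ≤ σ := by
    rw [hσ, div_le_div_iff₀ (by positivity) (by positivity)]
    have hrest : 0 ≤ (16 * Real.exp (9 / 2) * G₀ + C₁ + 1) * ell D ^ 9 := by positivity
    calc 4 * Real.exp (9 / 2) * ell D ^ 2 * F₀ * ell D ^ 7
        = (16 * Real.exp (9 / 2) * F₀) * ell D ^ 9 / 4 := by ring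
      _ ≤ ((16 * Real.exp (9 / 2) * F₀) * ell D ^ 9 +
            (16 * Real.exp (9 / 2) * G₀ + C₁ + 1) * ell D ^ 9) / 4 := by linarith
      _ = S * (ell D ^ 9 / 4) := by rw [hS]; ring
  have hσG : 4 * Real.exp (9 / 2) * ell D ^ 2 * G₀ / (ell D ^ 9 / 4) ≤ σ := by
    rw [hσ, div_le_div_iff₀ (by positivity) (by positivity)]
    have hrest : 0 ≤ (16 * Real.exp (9 / 2) * F₀ + C₁ + 1) * ell D ^ 9 := by positivity
    calc 4 * Real.exp (9 / 2) * ell D ^ 2 * G₀ * ell D ^ 7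
        = (16 * Real.exp (9 / 2) * G₀) * ell D ^ 9 / 4 := by ring
      _ ≤ ((16 * Real.exp (9 / 2) * G₀) * ell D ^ 9 +
            (16 * Real.exp (9 / 2) * F₀ + C₁ + 1) * ell D ^ 9) / 4 := by linarith
      _ = S * (ell D ^ 9 / 4) := by rw [hS]; ring
  -- the main-term sizes, abstractly
  have hAk : ∀ {Q y : ℝ} (μ : ℕ), ell D ^ 9 / 4 ≤ Real.log Q → 1 ≤ y → y ≤ bigP D →
      ‖deriv χ.LFunction 1 / (Real.log Q : ℂ) * frakfW c' D j μ y‖ ≤ σ := by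
    intro Q y μ hℓQ hy1 hyP
    have hlogQ : 0 < Real.log Q := lt_of_lt_of_le (by positivity) hℓQ
    have hf : ‖frakfW c' D j μ y‖ ≤ F₀ := by rw [hF₀]; exact norm_frakfW_le c' hD3' j μ hy1 hyP
    rw [norm_mul, norm_div, Complex.norm_real, Real.norm_of_nonneg hlogQ.le]
    calc ‖deriv χ.LFunction 1‖ / Real.log Q * ‖frakfW c' D j μ y‖
        ≤ 4 * Real.exp (9 / 2) * ell D ^ 2 / (ell D ^ 9 / 4) * F₀ :=
          mul_le_mul (div_le_div₀ (by positivity) hL' (by positivity) hℓQ) hf (norm_nonneg _)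
            (by positivity)
      _ = 4 * Real.exp (9 / 2) * ell D ^ 2 * F₀ / (ell D ^ 9 / 4) := by ring
      _ ≤ σ := hσF
  have hBk : ∀ {Q y : ℝ} (μ d r : ℕ), ell D ^ 9 / 4 ≤ Real.log Q → 1 ≤ y → y ≤ bigP D →
      ‖deriv χ.LFunction 1 * PiW χ d r / (Real.log Q : ℂ) * frakgW c' D j μ y‖ ≤
        σ * ‖PiW χ d r‖ := by
    intro Q y μ d r hℓQ hy1 hyP
    have hlogQ : 0 < Real.log Q := lt_of_lt_of_le (by positivity) hℓQ
    have hg : ‖frakgW c' D j μ y‖ ≤ G₀ := by rw [hG₀]; exact norm_frakgW_le c' hD3' j μ hy1 hyP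
    rw [norm_mul, norm_div, norm_mul, Complex.norm_real, Real.norm_of_nonneg hlogQ.le]
    calc ‖deriv χ.LFunction 1‖ * ‖PiW χ d r‖ / Real.log Q * ‖frakgW c' D j μ y‖
        = ‖deriv χ.LFunction 1‖ / Real.log Q * ‖frakgW c' D j μ y‖ * ‖PiW χ d r‖ := by ring
      _ ≤ 4 * Real.exp (9 / 2) * ell D ^ 2 / (ell D ^ 9 / 4) * G₀ * ‖PiW χ d r‖ :=
          mul_le_mul_of_nonneg_right
            (mul_le_mul (div_le_div₀ (by positivity) hL' (by positivity) hℓQ) hg (norm_nonneg _)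
              (by positivity)) (norm_nonneg _)
      _ = 4 * Real.exp (9 / 2) * ell D ^ 2 * G₀ / (ell D ^ 9 / 4) * ‖PiW χ d r‖ := by ring
      _ ≤ σ * ‖PiW χ d r‖ := mul_le_mul_of_nonneg_right hσG (norm_nonneg _)
  -- the objects
  set M₁ : ℕ × ℕ → ℂ := fun p => ∑ m ∈ Finset.Ico 1 (Nsupp D),
    χ (m : ZMod D) * vk1 D (p.1 * p.2 * m) / (m : ℂ) ^ (1 - betaJ c' D j) with hM₁
  set M₂ : ℕ × ℕ → ℂ := fun p => ∑ m ∈ Finset.Ico 1 (Nsupp D),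
    χ (m : ZMod D) * vk2 D (p.1 * p.2 * m) / (m : ℂ) ^ (1 - betaJ c' D j) with hM₂
  set N₁ : ℕ × ℕ → ℂ := fun p => ∑ n ∈ Finset.Ico 1 (Nsupp D),
    χ (n : ZMod D) * conj (vk1 D (p.1 * p.2 * n)) * xiZero c' D j n p.1 p.2 / (n : ℂ) with hN₁
  set N₂ : ℕ × ℕ → ℂ := fun p => ∑ n ∈ Finset.Ico 1 (Nsupp D),
    χ (n : ZMod D) * conj (vk2 D (p.1 * p.2 * n)) * xiZero c' D j n p.1 p.2 / (n : ℂ) with hN₂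
  set A₁ : ℕ × ℕ → ℂ := fun p => deriv χ.LFunction 1 / (Real.log (Skeleton.P1 D) : ℂ) *
    frakfW c' D j 6 (Skeleton.P1 D / ((p.1 * p.2 : ℕ) : ℝ)) with hA₁
  set A₂ : ℕ × ℕ → ℂ := fun p => deriv χ.LFunction 1 / (Real.log (Skeleton.P2 D) : ℂ) *
    frakfW c' D j 7 (Skeleton.P2 D / ((p.1 * p.2 : ℕ) : ℝ)) with hA₂
  set B₁ : ℕ × ℕ → ℂ := fun p => deriv χ.LFunction 1 * PiW χ p.1 p.2 /
    (Real.log (Skeleton.P1 D) : ℂ) * frakgW c' D j 6 (Skeleton.P1 D / ((p.1 * p.2 : ℕ) : ℝ)) with hB₁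
  set B₂ : ℕ × ℕ → ℂ := fun p => deriv χ.LFunction 1 * PiW χ p.1 p.2 /
    (Real.log (Skeleton.P2 D) : ℂ) * frakgW c' D j 7 (Skeleton.P2 D / ((p.1 * p.2 : ℕ) : ℝ)) with hB₂
  set w : ℕ × ℕ → ℂ := fun p => ((ArithmeticFunction.moebius p.2).natAbs : ℂ) *
    (‖χ ((p.1 * p.2 : ℕ) : ZMod D)‖ : ℂ) / (((p.1 * p.2 : ℕ) : ℂ) * (Nat.totient p.2 : ℂ)) *
    lamZero c' D j (p.1 * p.2) with hw
  -- Step 1: the exact form of `S_j`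
  have hSj : Sj c' D j (a11 χ) (a21 χ) =
      (∑ n ∈ Finset.Ico 1 ⌈Skeleton.P2 D⌉₊, ∑ p ∈ Nat.divisorsAntidiagonal n,
          w p * ((M₁ p + iota2 * M₂ p) * (N₁ p + conj iota2 * N₂ p))) +
        ∑ n ∈ Finset.Ico ⌈Skeleton.P2 D⌉₊ ⌈Skeleton.P1 D⌉₊, ∑ p ∈ Nat.divisorsAntidiagonal n,
          w p * (M₁ p * N₁ p) := by
    rw [Section8FrontEnd44Exact.Sj_a11_a21_eq c' hq hP1PT hP2P1 j]
  -- Step 2: the display's right side in the same form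
  have hTgt : deriv χ.LFunction 1 ^ 2 *
        (∑ n ∈ Finset.Ico 1 ⌈Skeleton.P2 D⌉₊, ∑ p ∈ Nat.divisorsAntidiagonal n,
          Section8cStatements.arithW c' χ j p.1 p.2 *
            (Section8cStatements.mFac c' D j n * Section8cStatements.nFac c' D j n)) +
      deriv χ.LFunction 1 ^ 2 *
        (∑ n ∈ Finset.Ico ⌈Skeleton.P2 D⌉₊ ⌈Skeleton.P1 D⌉₊, ∑ p ∈ Nat.divisorsAntidiagonal n,
          Section8cStatements.arithW c' χ j p.1 p.2 * Section8cStatements.diagFac c' D j n) =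
      (∑ n ∈ Finset.Ico 1 ⌈Skeleton.P2 D⌉₊, ∑ p ∈ Nat.divisorsAntidiagonal n,
          w p * ((A₁ p + iota2 * A₂ p) * (B₁ p + conj iota2 * B₂ p))) +
        ∑ n ∈ Finset.Ico ⌈Skeleton.P2 D⌉₊ ⌈Skeleton.P1 D⌉₊, ∑ p ∈ Nat.divisorsAntidiagonal n,
          w p * (A₁ p * B₁ p) := by
    congr 1
    · rw [Finset.mul_sum]
      refine Finset.sum_congr rfl fun n _ => ?_
      rw [Finset.mul_sum]
      refine Finset.sum_congr rfl fun p hp => ?_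
      obtain ⟨hpn, -⟩ := Nat.mem_divisorsAntidiagonal.mp hp
      simp only [hw, hA₁, hA₂, hB₁, hB₂, Section8cStatements.arithW, Section8cStatements.mFac,
        Section8cStatements.nFac]
      rw [← hpn]
      ring
    · rw [Finset.mul_sum]
      refine Finset.sum_congr rfl fun n _ => ?_
      rw [Finset.mul_sum]
      refine Finset.sum_congr rfl fun p hp => ?_
      obtain ⟨hpn, -⟩ := Nat.mem_divisorsAntidiagonal.mp hp
      simp only [hw, hA₁, hB₁, Section8cStatements.arithW, Section8cStatements.diagFac]
      rw [← hpn]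
      ring
  -- Step 3: pointwise inputs on the factorisations `n = dr`
  have hfacts : ∀ {n : ℕ} {p : ℕ × ℕ}, p ∈ Nat.divisorsAntidiagonal n →
      p.1 * p.2 = n ∧ 1 ≤ p.1 ∧ 1 ≤ p.2 ∧ 1 ≤ n := by
    intro n p hp
    obtain ⟨hpn, hn0⟩ := Nat.mem_divisorsAntidiagonal.mp hp
    refine ⟨hpn, Nat.one_le_iff_ne_zero.mpr fun h => hn0 (by rw [← hpn, h, zero_mul]),
      Nat.one_le_iff_ne_zero.mpr fun h => hn0 (by rw [← hpn, h, mul_zero]),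
      Nat.one_le_iff_ne_zero.mpr hn0⟩
  have hA₁p : ∀ {n : ℕ} {p : ℕ × ℕ}, p ∈ Nat.divisorsAntidiagonal n →
      (n : ℝ) < Skeleton.P1 D → ‖A₁ p‖ ≤ σ := by
    intro n p hp hn
    obtain ⟨hpn, -, -, hn1⟩ := hfacts hp
    have hn1R : (1 : ℝ) ≤ n := by exact_mod_cast hn1
    simp only [hA₁]
    rw [hpn]
    exact hAk 6 hlogP1' ((one_le_div (by linarith)).mpr hn.le)
      ((div_le_self hP1pos.le hn1R).trans hP1P.le)
  have hA₂p : ∀ {n : ℕ} {p : ℕ × ℕ}, p ∈ Nat.divisorsAntidiagonal n →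
      (n : ℝ) < Skeleton.P2 D → ‖A₂ p‖ ≤ σ := by
    intro n p hp hn
    obtain ⟨hpn, -, -, hn1⟩ := hfacts hp
    have hn1R : (1 : ℝ) ≤ n := by exact_mod_cast hn1
    simp only [hA₂]
    rw [hpn]
    exact hAk 7 hlogP2 ((one_le_div (by linarith)).mpr hn.le)
      ((div_le_self hP2pos.le hn1R).trans hP2P.le)
  have hB₁p : ∀ {n : ℕ} {p : ℕ × ℕ}, p ∈ Nat.divisorsAntidiagonal n →
      (n : ℝ) < Skeleton.P1 D → ‖B₁ p‖ ≤ σ * ‖PiW χ p.1 p.2‖ := by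
    intro n p hp hn
    obtain ⟨hpn, -, -, hn1⟩ := hfacts hp
    have hn1R : (1 : ℝ) ≤ n := by exact_mod_cast hn1
    simp only [hB₁]
    rw [hpn]
    exact hBk 6 p.1 p.2 hlogP1' ((one_le_div (by linarith)).mpr hn.le)
      ((div_le_self hP1pos.le hn1R).trans hP1P.le)
  have hB₂p : ∀ {n : ℕ} {p : ℕ × ℕ}, p ∈ Nat.divisorsAntidiagonal n →
      (n : ℝ) < Skeleton.P2 D → ‖B₂ p‖ ≤ σ * ‖PiW χ p.1 p.2‖ := by
    intro n p hp hn
    obtain ⟨hpn, -, -, hn1⟩ := hfacts hp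
    have hn1R : (1 : ℝ) ≤ n := by exact_mod_cast hn1
    simp only [hB₂]
    rw [hpn]
    exact hBk 7 p.1 p.2 hlogP2 ((one_le_div (by linarith)).mpr hn.le)
      ((div_le_self hP2pos.le hn1R).trans hP2P.le)
  have hMA₁ : ∀ {n : ℕ} {p : ℕ × ℕ}, p ∈ Nat.divisorsAntidiagonal n →
      (n : ℝ) < Skeleton.P1 D / bigT D → ‖M₁ p - A₁ p‖ ≤ δ := by
    intro n p hp hn
    obtain ⟨hpn, hp1, hp2, -⟩ := hfacts hp
    have hlt : ((p.1 * p.2 : ℕ) : ℝ) < Skeleton.P1 D / bigT D := by rw [hpn]; exact hn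
    simp only [hM₁, hA₁]
    exact h40 p.1 p.2 hp1 hp2 hlt
  have hMA₂ : ∀ {n : ℕ} {p : ℕ × ℕ}, p ∈ Nat.divisorsAntidiagonal n →
      (n : ℝ) < Skeleton.P2 D / bigT D → ‖M₂ p - A₂ p‖ ≤ δ := by
    intro n p hp hn
    obtain ⟨hpn, hp1, hp2, -⟩ := hfacts hp
    have hlt : ((p.1 * p.2 : ℕ) : ℝ) < Skeleton.P2 D / bigT D := by rw [hpn]; exact hn
    simp only [hM₂, hA₂]
    exact h41 p.1 p.2 hp1 hp2 hlt
  have hNB₁ : ∀ {n : ℕ} {p : ℕ × ℕ}, p ∈ Nat.divisorsAntidiagonal n →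
      (n : ℝ) < Skeleton.P1 D / bigT D →
        ‖N₁ p - B₁ p‖ ≤ δ * (∏ q ∈ n.primeFactors, (1 - (q : ℝ)⁻¹)⁻¹) ^ 2 := by
    intro n p hp hn
    obtain ⟨hpn, hp1, hp2, -⟩ := hfacts hp
    have hlt : ((p.1 * p.2 : ℕ) : ℝ) < Skeleton.P1 D / bigT D := by rw [hpn]; exact hn
    simp only [hN₁, hB₁]
    exact (h42 p.1 p.2 hp1 hp2 hlt).trans_eq (by rw [hpn])
  have hNB₂ : ∀ {n : ℕ} {p : ℕ × ℕ}, p ∈ Nat.divisorsAntidiagonal n →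
      (n : ℝ) < Skeleton.P2 D / bigT D →
        ‖N₂ p - B₂ p‖ ≤ δ * (∏ q ∈ n.primeFactors, (1 - (q : ℝ)⁻¹)⁻¹) ^ 2 := by
    intro n p hp hn
    obtain ⟨hpn, hp1, hp2, -⟩ := hfacts hp
    have hlt : ((p.1 * p.2 : ℕ) : ℝ) < Skeleton.P2 D / bigT D := by rw [hpn]; exact hn
    simp only [hN₂, hB₂]
    exact (h43 p.1 p.2 hp1 hp2 hlt).trans_eq (by rw [hpn])
  -- the tail ranges: `x = P_k/n ∈ [1, T]`
  have htail : ∀ {Q : ℝ} {n : ℕ}, 0 < Q → Q / bigT D ≤ n → (n : ℝ) < Q →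
      1 ≤ Q / n ∧ Q / n ≤ bigT D ∧ 0 ≤ Real.log (Q / n) ∧ Real.log (Q / n) ≤ τ := by
    intro Q n hQ hTn hn
    have hnR : (0 : ℝ) < n := lt_of_lt_of_le (div_pos hQ hT0) hTn
    have hx1 : 1 ≤ Q / n := (one_le_div hnR).mpr hn.le
    have hxT : Q / n ≤ bigT D := by
      rw [div_le_iff₀ hnR]
      have := (div_le_iff₀ hT0).mp hTn
      linarith [mul_comm (n : ℝ) (bigT D)]
    refine ⟨hx1, hxT, Real.log_nonneg hx1, ?_⟩
    rw [← hlogT]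
    exact Real.log_le_log (by positivity) hxT
  have hMm : ∀ {Q x : ℝ}, ell D ^ 9 / 4 ≤ Real.log Q → 0 ≤ Real.log x → Real.log x ≤ τ →
      Real.log x / Real.log Q * (1 + Real.log x) ≤ m := by
    intro Q x hℓQ h0 hτ'
    calc Real.log x / Real.log Q * (1 + Real.log x)
        ≤ τ / (ell D ^ 9 / 4) * (2 * τ) :=
          mul_le_mul (div_le_div₀ hτ0.le hτ' (by positivity) hℓQ) (by linarith) (by linarith)
            (div_nonneg hτ0.le (by positivity))
      _ = 8 * τ ^ 2 / ell D ^ 9 := by ring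
      _ = m := hm.symm
  have hNν : ∀ {Q x s : ℝ}, ell D ^ 9 / 4 ≤ Real.log Q → 0 ≤ Real.log x → Real.log x ≤ τ →
      0 ≤ s → s ≤ C₂ * ell D * (1 + Real.log x) ^ 3 → Real.log x / Real.log Q * s ≤ ν := by
    intro Q x s hℓQ h0 hτ' hs0 hs
    have h3 : (1 + Real.log x) ^ 3 ≤ (2 * τ) ^ 3 := pow_le_pow_left₀ (by linarith) (by linarith) 3
    calc Real.log x / Real.log Q * s
        ≤ τ / (ell D ^ 9 / 4) * (C₂ * ell D * (2 * τ) ^ 3) :=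
          mul_le_mul (div_le_div₀ hτ0.le hτ' (by positivity) hℓQ)
            (hs.trans (mul_le_mul_of_nonneg_left h3 (mul_nonneg hC₂ hL0.le))) hs0
            (div_nonneg hτ0.le (by positivity))
      _ = 32 * C₂ * τ ^ 4 / ell D ^ 8 := by field_simp; ring
      _ = ν := hν.symm
  have hM₁m : ∀ {n : ℕ} {p : ℕ × ℕ}, p ∈ Nat.divisorsAntidiagonal n →
      Skeleton.P1 D / bigT D ≤ n → (n : ℝ) < Skeleton.P1 D → ‖M₁ p‖ ≤ m := by
    intro n p hp hTn hn
    obtain ⟨hpn, -, -, hn1⟩ := hfacts hp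
    obtain ⟨-, -, h0, hτ'⟩ := htail hP1pos hTn hn
    have h := norm_M1_le c' χ hL2 j (k := p.1 * p.2) (by rw [hpn]; exact hn1) (by rw [hpn]; exact hn)
    have hcast : ((p.1 * p.2 : ℕ) : ℝ) = (n : ℝ) := by rw [hpn]
    rw [hcast] at h
    simp only [hM₁]
    exact h.trans (hMm hlogP1' h0 hτ')
  have hM₂m : ∀ {n : ℕ} {p : ℕ × ℕ}, p ∈ Nat.divisorsAntidiagonal n →
      Skeleton.P2 D / bigT D ≤ n → (n : ℝ) < Skeleton.P2 D → ‖M₂ p‖ ≤ m := by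
    intro n p hp hTn hn
    obtain ⟨hpn, -, -, hn1⟩ := hfacts hp
    obtain ⟨-, -, h0, hτ'⟩ := htail hP2pos hTn hn
    have h := norm_M2_le c' χ hL2 j (k := p.1 * p.2) (by rw [hpn]; exact hn1) (by rw [hpn]; exact hn)
    have hcast : ((p.1 * p.2 : ℕ) : ℝ) = (n : ℝ) := by rw [hpn]
    rw [hcast] at h
    simp only [hM₂]
    exact h.trans (hMm hlogP2 h0 hτ')
  have hN₁ν : ∀ {n : ℕ} {p : ℕ × ℕ}, p ∈ Nat.divisorsAntidiagonal n →
      Skeleton.P1 D / bigT D ≤ n → (n : ℝ) < Skeleton.P1 D → ‖N₁ p‖ ≤ ν := by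
    intro n p hp hTn hn
    obtain ⟨hpn, hp1, hp2, hn1⟩ := hfacts hp
    obtain ⟨hx1, hxT, h0, hτ'⟩ := htail hP1pos hTn hn
    have hkP : ((p.1 * p.2 : ℕ) : ℝ) < Skeleton.P1 D := by rw [hpn]; exact hn
    have h := norm_N1_le c' χ hL2 j p.1 p.2 (k := p.1 * p.2) (by rw [hpn]; exact hn1) hkP
    have hξ' := hξ p.1 p.2 hp1 hp2 hkP (Skeleton.P1 D / ((p.1 * p.2 : ℕ) : ℝ))
      (by rw [hpn]; exact hx1) (by rw [hpn]; exact hxT)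
    have hcast : ((p.1 * p.2 : ℕ) : ℝ) = (n : ℝ) := by rw [hpn]
    rw [hcast] at h hξ'
    simp only [hN₁]
    exact h.trans (hNν hlogP1' h0 hτ' (Finset.sum_nonneg fun _ _ => by positivity) hξ')
  have hN₂ν : ∀ {n : ℕ} {p : ℕ × ℕ}, p ∈ Nat.divisorsAntidiagonal n →
      Skeleton.P2 D / bigT D ≤ n → (n : ℝ) < Skeleton.P2 D → ‖N₂ p‖ ≤ ν := by
    intro n p hp hTn hn
    obtain ⟨hpn, hp1, hp2, hn1⟩ := hfacts hp
    obtain ⟨hx1, hxT, h0, hτ'⟩ := htail hP2pos hTn hn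
    have hkP : ((p.1 * p.2 : ℕ) : ℝ) < Skeleton.P2 D := by rw [hpn]; exact hn
    have hkP1 : ((p.1 * p.2 : ℕ) : ℝ) < Skeleton.P1 D := lt_of_lt_of_le hkP hP2P1
    have h := norm_N2_le c' χ hL2 j p.1 p.2 (k := p.1 * p.2) (by rw [hpn]; exact hn1) hkP
    have hξ' := hξ p.1 p.2 hp1 hp2 hkP1 (Skeleton.P2 D / ((p.1 * p.2 : ℕ) : ℝ))
      (by rw [hpn]; exact hx1) (by rw [hpn]; exact hxT)
    have hcast : ((p.1 * p.2 : ℕ) : ℝ) = (n : ℝ) := by rw [hpn]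
    rw [hcast] at h hξ'
    simp only [hN₂]
    exact h.trans (hNν hlogP2 h0 hτ' (Finset.sum_nonneg fun _ _ => by positivity) hξ')
  -- Step 4: the four range totals
  have hmem : ∀ {Y Z : ℝ} {n : ℕ}, n ∈ Finset.Ico ⌈Y⌉₊ ⌈Z⌉₊ → Y ≤ n ∧ (n : ℝ) < Z :=
    fun h => ⟨Nat.ceil_le.mp (Finset.mem_Ico.mp h).1, Nat.lt_ceil.mp (Finset.mem_Ico.mp h).2⟩
  have TI : ∑ n ∈ Finset.Ico 1 ⌈Skeleton.P2 D / bigT D⌉₊, ∑ p ∈ Nat.divisorsAntidiagonal n,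
      ‖w p‖ * ‖(M₁ p + iota2 * M₂ p) * (N₁ p + conj iota2 * N₂ p) -
        (A₁ p + iota2 * A₂ p) * (B₁ p + conj iota2 * B₂ p)‖ ≤
      2 * Real.exp 430 * (18 * δ * σ) * (1 + Real.log (Skeleton.P2 D / bigT D)) := by
    have h := range_sum_le_rel c' χ j (Y := 1) (Z := Skeleton.P2 D / bigT D) (E := 18 * δ * σ) le_rfl
      hP2T1 hEI0
      (fun p => (M₁ p + iota2 * M₂ p) * (N₁ p + conj iota2 * N₂ p) -
        (A₁ p + iota2 * A₂ p) * (B₁ p + conj iota2 * B₂ p))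
      (fun n hn p hp => by
        have hnlt : (n : ℝ) < Skeleton.P2 D / bigT D := (hmem hn).2
        have h1 : (n : ℝ) < Skeleton.P1 D / bigT D :=
          lt_of_lt_of_le hnlt (div_le_div_of_nonneg_right hP2P1 hT0.le)
        have h2 : (n : ℝ) < Skeleton.P2 D := lt_of_lt_of_le hnlt hP2TP2
        have h3 : (n : ℝ) < Skeleton.P1 D := lt_of_lt_of_le h2 hP2P1
        exact pointwise_I_rel hι (hMA₁ hp h1) (hMA₂ hp hnlt) (hNB₁ hp h1) (hNB₂ hp hnlt)
          (hA₁p hp h3) (hA₂p hp h2) (hB₁p hp h3) (hB₂p hp h2) (norm_nonneg _) hδσ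
          (one_le_relFac n))
    rw [Nat.ceil_one, div_one] at h
    simpa only [hw] using h
  have TII : ∑ n ∈ Finset.Ico ⌈Skeleton.P2 D / bigT D⌉₊ ⌈Skeleton.P2 D⌉₊,
      ∑ p ∈ Nat.divisorsAntidiagonal n,
      ‖w p‖ * ‖(M₁ p + iota2 * M₂ p) * (N₁ p + conj iota2 * N₂ p) -
        (A₁ p + iota2 * A₂ p) * (B₁ p + conj iota2 * B₂ p)‖ ≤
      2 * Real.exp 430 * (27 * σ ^ 2 + 12 * σ * ν + 12 * m * σ + 4 * m * ν) *
        (1 + Real.log (Skeleton.P2 D / (Skeleton.P2 D / bigT D))) := by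
    have h := range_sum_le_rel c' χ j (Y := Skeleton.P2 D / bigT D) (Z := Skeleton.P2 D)
      (E := 27 * σ ^ 2 + 12 * σ * ν + 12 * m * σ + 4 * m * ν) hP2T1 hP2TP2 hEII0
      (fun p => (M₁ p + iota2 * M₂ p) * (N₁ p + conj iota2 * N₂ p) -
        (A₁ p + iota2 * A₂ p) * (B₁ p + conj iota2 * B₂ p))
      (fun n hn p hp => by
        obtain ⟨hnT, hn2⟩ := hmem hn
        have h1 : (n : ℝ) < Skeleton.P1 D / bigT D := lt_of_lt_of_le hn2 hP2P1T
        have h3 : (n : ℝ) < Skeleton.P1 D := lt_of_lt_of_le hn2 hP2P1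
        exact pointwise_II_rel hι (hMA₁ hp h1) (hNB₁ hp h1) (hM₂m hp hnT hn2) (hN₂ν hp hnT hn2)
          (hA₁p hp h3) (hA₂p hp hn2) (hB₁p hp h3) (hB₂p hp hn2) (norm_nonneg _) hδσ
          (one_le_relFac n))
    simpa only [hw] using h
  have TIII : ∑ n ∈ Finset.Ico ⌈Skeleton.P2 D⌉₊ ⌈Skeleton.P1 D / bigT D⌉₊,
      ∑ p ∈ Nat.divisorsAntidiagonal n, ‖w p‖ * ‖M₁ p * N₁ p - A₁ p * B₁ p‖ ≤
      2 * Real.exp 430 * (2 * δ * σ) * (1 + Real.log (Skeleton.P1 D / bigT D / Skeleton.P2 D)) := by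
    have h := range_sum_le_rel c' χ j (Y := Skeleton.P2 D) (Z := Skeleton.P1 D / bigT D)
      (E := 2 * δ * σ) hP2one.le hP2P1T hEIII0 (fun p => M₁ p * N₁ p - A₁ p * B₁ p)
      (fun n hn p hp => by
        obtain ⟨-, hn2⟩ := hmem hn
        have h3 : (n : ℝ) < Skeleton.P1 D := lt_of_lt_of_le hn2 hP1TP1
        exact pointwise_III_rel (hMA₁ hp hn2) (hNB₁ hp hn2) (hA₁p hp h3) (hB₁p hp h3)
          (norm_nonneg _) hδσ (one_le_relFac n))
    simpa only [hw] using h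
  have TIV : ∑ n ∈ Finset.Ico ⌈Skeleton.P1 D / bigT D⌉₊ ⌈Skeleton.P1 D⌉₊,
      ∑ p ∈ Nat.divisorsAntidiagonal n, ‖w p‖ * ‖M₁ p * N₁ p - A₁ p * B₁ p‖ ≤
      2 * Real.exp 430 * (m * ν + σ ^ 2) * (1 + Real.log (Skeleton.P1 D / (Skeleton.P1 D / bigT D))) := by
    have h := range_sum_le_rel c' χ j (Y := Skeleton.P1 D / bigT D) (Z := Skeleton.P1 D)
      (E := m * ν + σ ^ 2) (hP2T1.trans (div_le_div_of_nonneg_right hP2P1 hT0.le)) hP1TP1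
      hEIV0 (fun p => M₁ p * N₁ p - A₁ p * B₁ p)
      (fun n hn p hp => by
        obtain ⟨hnT, hn2⟩ := hmem hn
        exact pointwise_IV_rel (hM₁m hp hnT hn2) (hN₁ν hp hnT hn2) (hA₁p hp hn2) (hB₁p hp hn2)
          (norm_nonneg _) (one_le_relFac n))
    simpa only [hw] using h
  -- Step 5: assemble
  have normbound : ∀ (s : Finset ℕ) (F G : ℕ × ℕ → ℂ),
      ‖(∑ n ∈ s, ∑ p ∈ Nat.divisorsAntidiagonal n, w p * F p) -
          ∑ n ∈ s, ∑ p ∈ Nat.divisorsAntidiagonal n, w p * G p‖ ≤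
        ∑ n ∈ s, ∑ p ∈ Nat.divisorsAntidiagonal n, ‖w p‖ * ‖F p - G p‖ := by
    intro s F G
    rw [← Finset.sum_sub_distrib]
    refine (norm_sum_le _ _).trans (Finset.sum_le_sum fun n _ => ?_)
    rw [← Finset.sum_sub_distrib]
    refine (norm_sum_le _ _).trans (Finset.sum_le_sum fun p _ => ?_)
    rw [← mul_sub, norm_mul]
  have h12 := normbound (Finset.Ico 1 ⌈Skeleton.P2 D⌉₊)
    (fun p => (M₁ p + iota2 * M₂ p) * (N₁ p + conj iota2 * N₂ p))
    (fun p => (A₁ p + iota2 * A₂ p) * (B₁ p + conj iota2 * B₂ p))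
  have h34 := normbound (Finset.Ico ⌈Skeleton.P2 D⌉₊ ⌈Skeleton.P1 D⌉₊)
    (fun p => M₁ p * N₁ p) (fun p => A₁ p * B₁ p)
  beta_reduce at h12 h34
  have hc1 : 1 ≤ ⌈Skeleton.P2 D / bigT D⌉₊ :=
    Nat.one_le_iff_ne_zero.mpr (Nat.ceil_pos.mpr (div_pos hP2pos hT0)).ne'
  have hc2 : ⌈Skeleton.P2 D / bigT D⌉₊ ≤ ⌈Skeleton.P2 D⌉₊ := Nat.ceil_mono hP2TP2
  have hc3 : ⌈Skeleton.P2 D⌉₊ ≤ ⌈Skeleton.P1 D / bigT D⌉₊ := Nat.ceil_mono hP2P1T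
  have hc4 : ⌈Skeleton.P1 D / bigT D⌉₊ ≤ ⌈Skeleton.P1 D⌉₊ := Nat.ceil_mono hP1TP1
  -- the logarithms of the range lengths
  have hlogA : Real.log (Skeleton.P2 D / bigT D) ≤ ell D ^ 9 := by
    rw [← hlogP]; exact Real.log_le_log (by positivity) (hP2TP2.trans hP2P.le)
  have hlogB : Real.log (Skeleton.P2 D / (Skeleton.P2 D / bigT D)) = τ := by
    rw [← hlogT]; congr 1; field_simp
  have hlogC : Real.log (Skeleton.P1 D / bigT D / Skeleton.P2 D) ≤ ell D ^ 9 := by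
    rw [← hlogP]
    refine Real.log_le_log (by positivity) (le_trans ?_ hP1P.le)
    rw [div_div]
    exact div_le_self hP1pos.le (one_le_mul_of_one_le_of_one_le hT1.le hP2one.le)
  have hlogD : Real.log (Skeleton.P1 D / (Skeleton.P1 D / bigT D)) = τ := by
    rw [← hlogT]; congr 1; field_simp
  have hL9 : 1 ≤ ell D ^ 9 := one_le_pow₀ hL1
  rw [hSj, hTgt, add_sub_add_comm]
  refine (norm_add_le _ _).trans ((add_le_add h12 h34).trans ?_)
  rw [← Finset.sum_Ico_consecutive _ hc1 hc2, ← Finset.sum_Ico_consecutive _ hc3 hc4]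
  refine (add_le_add (add_le_add TI TII) (add_le_add TIII TIV)).trans ?_
  rw [hlogB, hlogD]
  have hJ : 18 * δ * σ * (2 * ell D ^ 9) + (27 * σ ^ 2 + 12 * σ * ν + 12 * m * σ + 4 * m * ν) *
      (2 * τ) + 2 * δ * σ * (2 * ell D ^ 9) + (m * ν + σ ^ 2) * (2 * τ) ≤
      (40 * C₁ * S + 56 * S ^ 2 + 768 * S * C₂ + 192 * S + 2560 * C₂) * u := by
    linarith [s1, s2, s3, s4, s5]
  calc 2 * Real.exp 430 * (18 * δ * σ) * (1 + Real.log (Skeleton.P2 D / bigT D)) +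
        2 * Real.exp 430 * (27 * σ ^ 2 + 12 * σ * ν + 12 * m * σ + 4 * m * ν) * (1 + τ) +
        (2 * Real.exp 430 * (2 * δ * σ) * (1 + Real.log (Skeleton.P1 D / bigT D / Skeleton.P2 D)) +
          2 * Real.exp 430 * (m * ν + σ ^ 2) * (1 + τ))
      ≤ 2 * Real.exp 430 * (18 * δ * σ) * (2 * ell D ^ 9) +
        2 * Real.exp 430 * (27 * σ ^ 2 + 12 * σ * ν + 12 * m * σ + 4 * m * ν) * (2 * τ) +
        (2 * Real.exp 430 * (2 * δ * σ) * (2 * ell D ^ 9) +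
          2 * Real.exp 430 * (m * ν + σ ^ 2) * (2 * τ)) :=
        add_le_add
          (add_le_add (mul_le_mul_of_nonneg_left (by linarith) (mul_nonneg he430 hEI0))
            (mul_le_mul_of_nonneg_left (by linarith) (mul_nonneg he430 hEII0)))
          (add_le_add (mul_le_mul_of_nonneg_left (by linarith) (mul_nonneg he430 hEIII0))
            (mul_le_mul_of_nonneg_left (by linarith) (mul_nonneg he430 hEIV0)))
    _ = 2 * Real.exp 430 * (18 * δ * σ * (2 * ell D ^ 9) +
        (27 * σ ^ 2 + 12 * σ * ν + 12 * m * σ + 4 * m * ν) * (2 * τ) +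
        2 * δ * σ * (2 * ell D ^ 9) + (m * ν + σ ^ 2) * (2 * τ)) := by ring
    _ ≤ 2 * Real.exp 430 * ((40 * C₁ * S + 56 * S ^ 2 + 768 * S * C₂ + 192 * S + 2560 * C₂) * u) :=
        mul_le_mul_of_nonneg_left hJ (by positivity)
    _ = Real.exp 430 * (80 * C₁ * S + 112 * S ^ 2 + 1536 * S * C₂ + 384 * S + 5120 * C₂) * u := by
        ring


/-! ## `Z22:§8.u044` from the relative twins, and the cone consequences -/

/-- **The gathering display `Step8u044 c′` from `u040/u041` (Lemma 8.2, `c′ ≥ 0`) and the RELATIVE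
twins of `u042/u043`** (errors `C𝓛⁻¹⁵·(∏_{q∣dr}(1−q⁻¹)⁻¹)²`): the relative factor is absorbed by
the weights. [cite: Zhang2022LandauSiegel, §8 display before (8.10) p.47, tex L2436] -/
theorem step8u044_of_rel {c' : ℝ} (hc' : 0 ≤ c')
    (h42 : ∃ C : ℝ, ForAllLarge fun D _ χ => AssumptionA D χ →
      ∀ j ∈ ({1, 2, 3} : Finset ℕ), ∀ d r : ℕ, 1 ≤ d → 1 ≤ r →
        ((d * r : ℕ) : ℝ) < Skeleton.P1 D / bigT D →
          ‖(∑ n ∈ Finset.Ico 1 (Nsupp D),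
                χ (n : ZMod D) * conj (vk1 D (d * r * n)) * xiZero c' D j n d r / (n : ℂ)) -
              deriv χ.LFunction 1 * PiW χ d r / (Real.log (Skeleton.P1 D) : ℂ) *
                frakgW c' D j 6 (Skeleton.P1 D / ((d * r : ℕ) : ℝ))‖ ≤
            C * (ell D ^ 15)⁻¹ * (∏ q ∈ (d * r).primeFactors, (1 - (q : ℝ)⁻¹)⁻¹) ^ 2)
    (h43 : ∃ C : ℝ, ForAllLarge fun D _ χ => AssumptionA D χ →
      ∀ j ∈ ({1, 2, 3} : Finset ℕ), ∀ d r : ℕ, 1 ≤ d → 1 ≤ r →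
        ((d * r : ℕ) : ℝ) < Skeleton.P2 D / bigT D →
          ‖(∑ n ∈ Finset.Ico 1 (Nsupp D),
                χ (n : ZMod D) * conj (vk2 D (d * r * n)) * xiZero c' D j n d r / (n : ℂ)) -
              deriv χ.LFunction 1 * PiW χ d r / (Real.log (Skeleton.P2 D) : ℂ) *
                frakgW c' D j 7 (Skeleton.P2 D / ((d * r : ℕ) : ℝ))‖ ≤
            C * (ell D ^ 15)⁻¹ * (∏ q ∈ (d * r).primeFactors, (1 - (q : ℝ)⁻¹)⁻¹) ^ 2) :
    Section8cStatements.Step8u044 c' := by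
  intro ε hε
  obtain ⟨C40, D40, h40⟩ := step8u040_holds hc'
  obtain ⟨C41, D41, h41⟩ := step8u041_holds hc'
  obtain ⟨C42, D42, h42⟩ := h42
  obtain ⟨C43, D43, h43⟩ := h43
  obtain ⟨Cξ, Dξ, hξ⟩ := XiZeroMajorant.xiZeroTailMean c'
  set C₁ : ℝ := max (max |C40| |C41|) (max |C42| |C43|) with hC₁def
  have h40le : |C40| ≤ C₁ := le_trans (le_max_left _ _) (le_max_left _ _)
  have h41le : |C41| ≤ C₁ := le_trans (le_max_right _ _) (le_max_left _ _)
  have h42le : |C42| ≤ C₁ := le_trans (le_max_left _ _) (le_max_right _ _)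
  have h43le : |C43| ≤ C₁ := le_trans (le_max_right _ _) (le_max_right _ _)
  have hC₁ : 0 ≤ C₁ := (abs_nonneg C40).trans h40le
  set C₂ : ℝ := max Cξ 0 with hC₂def
  have hC₂ : 0 ≤ C₂ := le_max_right _ _
  obtain ⟨K, hK0, hcore⟩ := coreRel c' hC₁ hC₂
  set Dfin : ℕ := ⌈Real.exp (K ^ 10 / (ε * π) ^ 10)⌉₊ with hDfin
  refine ⟨max (max (max D40 D41) (max D42 D43)) (max Dξ (max ⌈Real.exp 3⌉₊ Dfin)),
    fun D _ χ hD hq hp hA j hj => ?_⟩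
  have hD40 : D40 ≤ D := le_trans (le_trans (le_max_left _ _) (le_max_left _ _)) (le_trans (le_max_left _ _) hD)
  have hD41 : D41 ≤ D := le_trans (le_trans (le_max_right _ _) (le_max_left _ _)) (le_trans (le_max_left _ _) hD)
  have hD42 : D42 ≤ D := le_trans (le_trans (le_max_left _ _) (le_max_right _ _)) (le_trans (le_max_left _ _) hD)
  have hD43 : D43 ≤ D := le_trans (le_trans (le_max_right _ _) (le_max_right _ _)) (le_trans (le_max_left _ _) hD)
  have hDξ : Dξ ≤ D := le_trans (le_max_left _ _) (le_trans (le_max_right _ _) hD)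
  have hD3 : ⌈Real.exp 3⌉₊ ≤ D :=
    le_trans (le_trans (le_max_left _ _) (le_max_right _ _)) (le_trans (le_max_right _ _) hD)
  have hDf : Dfin ≤ D :=
    le_trans (le_trans (le_max_right _ _) (le_max_right _ _)) (le_trans (le_max_right _ _) hD)
  have hL3 : 3 ≤ ell D := three_le_ell hD3
  have hL1 : 1 ≤ ell D := by linarith
  have hL0 : 0 < ell D := by linarith
  have hinv : ∀ {C : ℝ}, |C| ≤ C₁ → C * (ell D ^ 15)⁻¹ ≤ C₁ / ell D ^ 15 := by
    intro C hC
    rw [div_eq_mul_inv]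
    exact mul_le_mul_of_nonneg_right ((le_abs_self C).trans hC) (by positivity)
  have hinvR : ∀ {C R : ℝ}, |C| ≤ C₁ → 0 ≤ R →
      C * (ell D ^ 15)⁻¹ * R ≤ C₁ / ell D ^ 15 * R := by
    intro C R hC hR
    exact mul_le_mul_of_nonneg_right (hinv hC) hR
  have key := hcore hq hp hD3 j
    (fun d r hd hr hdr => (h40 D χ hD40 hq hp hA j hj d r hd hr hdr).trans (hinv h40le))
    (fun d r hd hr hdr => (h41 D χ hD41 hq hp hA j hj d r hd hr hdr).trans (hinv h41le))
    (fun d r hd hr hdr =>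
      (h42 D χ hD42 hq hp hA j hj d r hd hr hdr).trans (hinvR h42le (sq_nonneg _)))
    (fun d r hd hr hdr =>
      (h43 D χ hD43 hq hp hA j hj d r hd hr hdr).trans (hinvR h43le (sq_nonneg _)))
    (fun d r hd hr hdr x hx1 hxT =>
      (hξ D χ hDξ hq hp j hj d r hd hr hdr x hx1 hxT).trans
        (mul_le_mul_of_nonneg_right (mul_le_mul_of_nonneg_right (le_max_left _ _) hL0.le)
          (pow_nonneg (by linarith [Real.log_nonneg hx1]) 3)))
  have hLK : K ^ 10 / (ε * π) ^ 10 ≤ ell D := by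
    have hexp : Real.exp (K ^ 10 / (ε * π) ^ 10) ≤ D :=
      le_trans (Nat.le_ceil _) (by exact_mod_cast hDf)
    exact (Real.le_log_iff_exp_le (lt_of_lt_of_le (Real.exp_pos _) hexp)).mpr hexp
  calc _ ≤ K * (ell D ^ (1.1 : ℝ)) ^ 7 / ell D ^ 17 := key
    _ ≤ ε * π / ell D ^ 9 := final_small (by positivity) hL1 hLK
    _ = ε * alpha D := by rw [Section2.alpha_eq_pi_div_ell9]; ring

/-- **The gathering display from the RELATIVE Lemma 8.4** (`c′ ≥ 0`):
`Skeleton.Lemma84Rel c′ → Section8cStatements.Step8u044 c′`.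
[cite: Zhang2022LandauSiegel, §8 display before (8.10) p.47, tex L2436] -/
theorem step8u044_of_lemma84Rel {c' : ℝ} (hc' : 0 ≤ c') (h84 : Lemma84Rel c') :
    Section8cStatements.Step8u044 c' :=
  step8u044_of_rel hc'
    (u042R_of_lemma84W c' (W := fun n => (∏ q ∈ n.primeFactors, (1 - (q : ℝ)⁻¹)⁻¹) ^ 2)
      (fun _ => sq_nonneg _) h84)
    (u043R_of_lemma84W c' (W := fun n => (∏ q ∈ n.primeFactors, (1 - (q : ℝ)⁻¹)⁻¹) ^ 2)
      (fun _ => sq_nonneg _) h84)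

/-- **(8.12) from the RELATIVE Lemma 8.4** (`c′ ≥ 0`): gathering, (8.10), substitution, (8.11),
(8.12). [cite: Zhang2022LandauSiegel, §8 (8.12) p.48] -/
theorem eq812_of_lemma84Rel {c' : ℝ} (hc' : 0 ≤ c') (h84 : Lemma84Rel c') :
    Section8cStatements.Eq812 c' :=
  Section8Ded823.eq812_of_step8u046 c'
    (Section8FrontEnd810.dedStep8u046_holds c' (step8u044_of_lemma84Rel hc' h84)
      Section8FrontEnd810.eq810_holds)

/-- **The cone leaf `Skeleton.Ded823Rel c′` HOLDS for every `c′ ≥ 0`** (the v8+ relative form of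
the deduction node of (8.23): `Eq87 → Prop71 → Lemma82 → Lemma83Rel → Lemma84Rel → Eval823`), via
seat d29's `Section8Ded823.ded823Rel_of_eq812_edge`. [cite: Zhang2022LandauSiegel, §8 (8.9)–(8.23) pp.46–50] -/
theorem ded823Rel_holds {c' : ℝ} (hc' : 0 ≤ c') : Ded823Rel c' :=
  Section8Ded823.ded823Rel_of_eq812_edge c' fun h84 => eq812_of_lemma84Rel hc' h84

/-- **Cone leaf `Sec8C.SjWeightedEval c′` (hSj of `theorem1_of_leaves_v13`) ⇐ the leaf
`Lemma84Rel c′` (h84)**, for `c′ ≥ 0`. [cite: Zhang2022LandauSiegel, §8 p.49, tex L2523] -/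
theorem sjWeightedEval_of_lemma84Rel {c' : ℝ} (hc' : 0 ≤ c') (h84 : Lemma84Rel c') :
    Sec8C.SjWeightedEval c' :=
  Section8ConeLeaves823.sjWeightedEval_of_eq812 (eq812_of_lemma84Rel hc' h84)

/-- **Cone leaf `Sec8C.EcalNegligible c′` (hEc of `theorem1_of_leaves_v13`) ⇐ the leaf
`Lemma84Rel c′` (h84)**, for `c′ ≥ 0`. [cite: Zhang2022LandauSiegel, §8 p.50, "It follows by Proposition 7.1"] -/
theorem ecalNegligible_of_lemma84Rel {c' : ℝ} (hc' : 0 ≤ c') (h84 : Lemma84Rel c') :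
    Sec8C.EcalNegligible c' :=
  Section8ConeLeaves823.ecalNegligible_of_eq812 (eq812_of_lemma84Rel hc' h84)

end Literature.NumberTheory.LFunctions.Zhang2022.Section8FrontEnd44ReductionRel
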